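import Mathlib
import Literature.NumberTheory.LFunctions.Zhang2022.SkeletonPartOne
import Literature.NumberTheory.LFunctions.Zhang2022.Section3ExceptionalSet
import Literature.NumberTheory.LFunctions.Zhang2022.TypedSection03
import Literature.NumberTheory.LFunctions.Zhang2022.Section3Lemma36Holds
import Literature.Analysis.Complex.CahenMellinDirichlet
import HarnessLib

/-!
# Zhang (2022), §3 wave-2 EDGES: the three counting steps «Thus we conclude» Lemmas 3.4, 3.5, 3.6
# from the second-moment bounds, and the parameter step `P²𝓛⁻¹⁹⁹³ ≪ 𝔓𝓛⁻¹⁹⁰⁹` — kernel-proved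

Topic `Literature/NumberTheory/LFunctions/Zhang2022` (Landau–Siegel audit tree; verdict-neutral).
Y. Zhang, *Discrete mean estimates and the Landau–Siegel zero*, arXiv:2211.02515v1 (2022)
[Zhang2022LandauSiegel] — **an unrefereed manuscript under adjudication; nothing here asserts or
denies its Theorems 1–2.** Campaign D-0069, layer L1, §3 edges (companion of `TypedSection03`,
whose CLAIM nodes `Step3u019`, `Step3u021a/b`, `Step3u025` are the antecedents below, written out
INLINE and definitionally equal to them, so that `Ded34/35/36` of that file follow by `exact`).

PROVED here (theorems only, no new definitions, no facts):

* `ncard_not_lt_le_of_finsum_sq_le` — finite Chebyshev in the skeleton's vocabulary: on a finite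
  index type, `Σᶠ f² ≤ B` and `V > 0` give `#{i : ¬ f i < V} ≤ B/V²` (tree
  `Zhang2022.card_filter_le_div_sq`);
* `lemma34_of_moment` — §3 p.15, tex L810–821: the second moment
  `Σ_{ψ∈Ψ}(|X₁(D⁸⁰,ψ)| + |X₂(D⁸⁰,ψ)| + ∫₁^{D⁸⁰}(|X₁|+|X₂|)dx/x)² ≪ 𝔓𝓛¹⁶⁰²` (`Z22:§3.u019`) IMPLIES
  Lemma 3.4 = `Skeleton.Lemma34` («(3.4) holds for all but at most `O(𝔓𝓛⁻⁷⁴⁰)` characters»;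
  `1602 − 2·1171 = −740`);
* `bigP_sq_le_frakP` — the parameter step of `Z22:§3.u021`, «`P²𝓛⁻¹⁹⁹³ ≪ 𝔓𝓛⁻¹⁹⁰⁹`», with constant
  `2`, from (2.9) in the tree's form `Zhang2022.frakP_bounds` (`𝔓 = P²𝓛⁻⁷⁷(1 + O(𝓛⁻⁶⁸))`);
* `lemma35_of_moment` — §3 p.15, tex L828–839: `Z22:§3.u021` (both `≪`) IMPLIES `Skeleton.Lemma35`
  (`−1909 + 2·585 = −739`);
* `lemma36_of_moment` — §3 p.16, tex L854–866: `Z22:§3.u025` IMPLIES `Skeleton.Lemma36`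
  (`−2005 + 2·633 = −739`).

Together with the banked edge `Skeleton.prop21_of_lemmas` these close the kernel path
second moments ⇒ Lemmas 3.4–3.6 ⇒ Proposition 2.1; the second moments themselves (Cauchy +
Lemma 3.3 + Lemmas 3.1/3.2) remain CLAIM nodes of `TypedSection03`.

APPEND (wave-2b, theorems only; now importing the landed `TypedSection03` and the `ν/υ` bridges of
`Section3Lemma36Holds`) — DISCHARGES of `TypedSection03` nodes by name:

* `ded34_holds`, `ded35_holds`, `ded36_holds` — the deduction nodes `Ded34/35/36` (= the edges above);
* `step3u021b_holds : Step3u021b` (= `bigP_sq_le_frakP`);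
* `step3u001_ups`, `step3u001_holds : Step3u001 χ` — `Z22:§3.u001`, §3 p.12 tex L704–707: for
  `σ > 1`, `Σ ν(n)n⁻ˢ = ζ(s)L(s,χ)` and `Σ υ(n)n⁻ˢ = ζ(s)⁻¹L(s,χ)⁻¹` (`υ = μ ∗ χμ`, Möbius inversion);
* `eq31_holds (hχ : χ² = 1) : Eq31 χ` — `Z22:(3.1)` p.12: `ν(n)` real, `|υ(n)| ≤ ν(n) ≤ τ₂(n)` for the
  real character of the setting (the reality hypothesis `χ² = 1` is the setting's, made explicit);
* `step3u009_holds : Step3u009` — `Z22:§3.u009`, §3 p.13 tex L747–748: on `|s| = α* = 𝓛⁻²⁰²⁴`,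
  `ζ(1+s) ≪ 𝓛²⁰²⁴` and `(P^{2s} − D^{4s})Γ(s) ≪ 𝓛⁹` (constant `72`; from `ζ(1+s) = 1/s + O(1)`,
  `Γ(s) = Γ(s+1)/s`, `|P^{2s} − D^{4s}| ≤ 6|s|(2𝓛⁹ + 4𝓛)`), core form `step3u009_core` (private elementary lemmas
  `norm_zeta_one_add_le_near_zero`, `norm_Gamma_le_two_near_one`, `ofReal_cpow_eq_exp_log`,
  `norm_exp_sub_exp_le_of_half`);
* `phiLocal_eq`, `phiLocal_eq_of_sq_eq_one`, `phiLocal_eq_of_eq_zero` — §3 p.13 tex L722–728: the local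
  factor `φ_p(s)` of `φ = ζ⁻²L⁻²Σν²n⁻ˢ` in closed form for `σ > 0`, `= 1 − p^{−2s}` if `χ(p) = ±1` and
  `= 1 − p⁻ˢ` if `χ(p) = 0`; hence `step3u004_holds : Step3u004` (`C = 1`) and
  `step3u005_holds : Step3u005` (`C = 0`: the printed `O(p^{−2σ})` vanishes identically);
* `eq33_holds : Eq33` — (3.3), `‖φ(s)‖ ≤ S e^{2S}∏_{p∣D}|1 − p⁻ˢ|` for `σ ≥ σ₁ > 1/2`, `S = Σ n^{−2σ₁}`.

APPEND (wave-2d, theorems only):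

* `step3u003_holds : Step3u003 χ` — `Z22:§3.u003`, p.13 tex L722: the Euler product `φ(s) = ∏_p φ_p(s)`
  (`σ > 1`) as a `HasProd` over `Nat.Primes` (Mathlib `EulerProduct.eulerProduct_hasProd` for the
  multiplicative summand `ν(n)²n⁻ˢ`, and the Euler products of `ζ`, `L(·,χ)` inverted by continuity);
* `step3u006a_holds : Step3u006a` — `Z22:§3.u006` first line, p.13 tex L734: the smoothing step
  `Σ_{D⁴<n≤P²} ν(n)²/n ≤ 6·Σ_n |ν(n)|²n⁻¹(e^{−n/P²} − e^{−n/D⁴})` (tree `Lemma31.sum_Ioc_le`, `4D⁴ ≤ P²`);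
* `step3u006b_holds : Step3u006b` — `Z22:§3.u006` second line, p.13 tex L737: the Mellin identity on the
  line `Re s = 1`, `Σ_n |ν(n)|²n⁻¹(e^{−n/P²} − e^{−n/D⁴}) = (1/2π)∫ φ(2+iy)ζ(2+iy)²L(2+iy,χ)²(P^{2(1+iy)} −
  D^{4(1+iy)})Γ(1+iy) dy` (tree Cahen–Mellin `tsum_mul_exp_neg_eq_integral_LSeries` at `c = 1` for the
  coefficients `ν(n)²/n ≪ n^{−1/2}`, applied at `w = 1/P²` and `w = 1/D⁴`).

APPEND (wave-2e, theorems only):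

* `step3u013_core`, `step3u013_holds : Step3u013` — `Z22:§3.u013`, p.14 tex L773: under (A), the circle
  integral `∮_{|s|=α*} φ*(1+s)ζ(1+s)⁸L(1+s,χ)⁸(D^{8s} − D^{4s})Γ(s) ds` is `≪ 𝓛⁻²⁰⁰⁷` (integrand
  `≪ 𝓛^{8·2024 − 8·2022 + 1} = 𝓛¹⁷` on the circle of length `2π𝓛⁻²⁰²⁴`; `φ*(1+s)` absolutely bounded by
  the tree's `PhiStar.norm_phiStar_le_of_re_cpow_nonneg`).

APPEND (wave-2f, theorems only):

* (private) `integral_vertical_sub_eq_of_double_pole`, `circleIntegral_div_sq_eq`,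
  `circleIntegral_div_eq` — generic: the strip residue theorem across a DOUBLE pole (via `dslope` and the tree's simple-pole
  theorem `HuxleyZeroDetection.integral_vertical_sub_eq_of_pole`, `∫ dy/(c+iy)² = 0`) and Cauchy's
  formulae on a small circle;
* `step3u007_holds : Step3u007` — `Z22:§3.u007`, p.13 tex L740–744: under (A), `(1/2π)∫_{(1)} −
  (1/2πi)∮_{|s|=α*}` of `φ(1+s)ζ(1+s)²L(1+s,χ)²(P^{2s} − D^{4s})Γ(s)` is `≤ C·D^{−1/4}`: the integrand
  splits as `N(z)/z + g(0)M(z)/z²` (tree numerator `DivisorSumCharSq.numer`, divisor kernel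
  `M = ζ₁(1+z)²Γ(z+1)ε(z)`), both are shifted to `re z = −1/4`, the residues are the circle
  integrals, and the shifted integrals are `≪ d(D)²D^{1/4}(1+𝓛)³D⁻¹ + D⁻¹ ≪ D^{−1/4}` (tree
  `Lemma31.norm_integral_line_le`, Pólya–Vinogradov convexity for `L(3/4+iy,χ)`).

## References

* Y. Zhang, arXiv:2211.02515v1 (2022), §3 pp. 15–16, Lemmas 3.4–3.6; §2 (2.9).
  [cite: Zhang2022LandauSiegel, §3 Lemmas 3.4–3.6]
-/

noncomputable section

open Complex Real MeasureTheory

namespace Literature.NumberTheory.LFunctions.Zhang2022.Section3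

/-! ## Finite Chebyshev, skeleton vocabulary -/

/-- **Counting from a second moment**: on a finite index type, if `Σᶠ_i f(i)² ≤ B` and `V > 0`,
then the number of `i` with `¬ (f i < V)` is at most `B/V²` (the step «Thus we conclude» of
Lemmas 3.4–3.6). [cite: Zhang2022LandauSiegel, §3 Lemmas 3.4–3.6] -/
theorem ncard_not_lt_le_of_finsum_sq_le {ι : Type*} [Finite ι] (f : ι → ℝ) {V B : ℝ}
    (hV : 0 < V) (h : ∑ᶠ i, f i ^ 2 ≤ B) :
    (({i | ¬ f i < V}.ncard : ℕ) : ℝ) ≤ B / V ^ 2 := by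
  classical
  haveI : Fintype ι := Fintype.ofFinite ι
  rw [finsum_eq_sum_of_fintype] at h
  have hset : {i | ¬ f i < V} = ↑(Finset.univ.filter fun i => V ≤ f i) := by
    ext i; simp [not_lt]
  rw [hset, Set.ncard_coe_finset]
  exact card_filter_le_div_sq Finset.univ f hV h

/-- `𝓛 = log D ≥ 1` for `D ≥ 3`. [folklore] -/
private theorem one_le_ell {D : ℕ} (hD : 3 ≤ D) : 1 ≤ Skeleton.ell D := by
  have hD' : (3 : ℝ) ≤ D := by exact_mod_cast hD
  have h : (1 : ℝ) < Real.log 3 := by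
    rw [Real.lt_log_iff_exp_lt (by norm_num)]
    exact Real.exp_one_lt_d9.trans (by norm_num)
  exact le_trans h.le (Real.log_le_log (by norm_num) hD')

/-! ## Lemma 3.4 from its second moment -/

/-- **§3 p.15 «Thus we conclude Lemma 3.4»** (tex L810–821): the second-moment bound
`Σ_{ψ∈Ψ}(|X₁(D⁸⁰,ψ)| + |X₂(D⁸⁰,ψ)| + ∫₁^{D⁸⁰}(|X₁(x,ψ)|+|X₂(x,ψ)|)dx/x)² ≪ 𝔓𝓛¹⁶⁰²` (the CLAIM
`Section3.Step3u019` of `TypedSection03`, written out) implies `Skeleton.Lemma34`: (3.4) fails for at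
most `C𝔓𝓛^{1602−2·1171} = C𝔓𝓛⁻⁷⁴⁰` characters, with the SAME implied constant `C`. Kernel-checked.
[cite: Zhang2022LandauSiegel, §3 Lemma 3.4 p.15] -/
theorem lemma34_of_moment
    (h : ∃ C : ℝ, Skeleton.ForAllLarge fun D _ χ =>
      ∑ᶠ x : Skeleton.Chr D,
        (‖Skeleton.X1 χ x ((D : ℝ) ^ 80)‖ + ‖Skeleton.X2 χ x ((D : ℝ) ^ 80)‖
          + ∫ y in (1 : ℝ)..(D : ℝ) ^ 80, (‖Skeleton.X1 χ x y‖ + ‖Skeleton.X2 χ x y‖) / y) ^ 2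
        ≤ C * frakP D * Skeleton.ell D ^ 1602) :
    Skeleton.Lemma34 := by
  obtain ⟨C, D₀, hD₀⟩ := h
  refine ⟨C, max D₀ 3, fun D _ χ hD hq hp => ?_⟩
  have hmom := hD₀ D χ (le_trans (le_max_left _ _) hD) hq hp
  dsimp only at hmom ⊢
  have hℓ : 0 < Skeleton.ell D := lt_of_lt_of_le one_pos (one_le_ell (le_trans (le_max_right _ _) hD))
  have hV : 0 < Skeleton.ell D ^ 1171 := pow_pos hℓ _
  have key := ncard_not_lt_le_of_finsum_sq_le
    (fun x : Skeleton.Chr D => ‖Skeleton.X1 χ x ((D : ℝ) ^ 80)‖ + ‖Skeleton.X2 χ x ((D : ℝ) ^ 80)‖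
      + ∫ y in (1 : ℝ)..(D : ℝ) ^ 80, (‖Skeleton.X1 χ x y‖ + ‖Skeleton.X2 χ x y‖) / y) hV hmom
  have hset : {x : Skeleton.Chr D | ¬ Skeleton.Ineq34 χ x} =
      {x | ¬ (‖Skeleton.X1 χ x ((D : ℝ) ^ 80)‖ + ‖Skeleton.X2 χ x ((D : ℝ) ^ 80)‖
        + ∫ y in (1 : ℝ)..(D : ℝ) ^ 80, (‖Skeleton.X1 χ x y‖ + ‖Skeleton.X2 χ x y‖) / y
          < Skeleton.ell D ^ 1171)} := rfl
  rw [hset]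
  refine key.trans (le_of_eq ?_)
  have hℓ0 : Skeleton.ell D ≠ 0 := hℓ.ne'
  field_simp

/-! ## The parameter step of Lemma 3.5 -/

/-- **«`P²𝓛⁻¹⁹⁹³ ≪ 𝔓𝓛⁻¹⁹⁰⁹`»** (§3 p.15, tex L829, second `≪` of `Z22:§3.u021`; the CLAIM
`Section3.Step3u021b` of `TypedSection03` with `C = 2`): from (2.9) in the tree's quantitative form
`|𝔓 − P²𝓛⁻⁷⁷| ≤ 3𝓛⁻⁶⁸·P²𝓛⁻⁷⁷` (`Zhang2022.frakP_bounds`) one has `P²𝓛⁻⁷⁷ ≤ 2𝔓` once `𝓛 ≥ 2`,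
whence `P²𝓛⁻¹⁹⁹³ = P²𝓛⁻⁷⁷·𝓛⁻¹⁹¹⁶ ≤ 2𝔓𝓛⁻¹⁹¹⁶ ≤ 2𝔓𝓛⁻¹⁹⁰⁹`. Kernel-checked.
[cite: Zhang2022LandauSiegel, §3 Lemma 3.5 p.15; §2 (2.9)] -/
theorem bigP_sq_le_frakP :
    ∃ C : ℝ, ∃ D₀ : ℕ, ∀ D : ℕ, D₀ ≤ D →
      Skeleton.bigP D ^ 2 * (Skeleton.ell D ^ 1993)⁻¹ ≤ C * frakP D * (Skeleton.ell D ^ 1909)⁻¹ := by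
  obtain ⟨D₀, hD₀⟩ := frakP_bounds
  refine ⟨2, max D₀ ⌈Real.exp 2⌉₊, fun D hD => ?_⟩
  have hb := hD₀ D (le_trans (le_max_left _ _) hD)
  -- `𝓛 ≥ 2`
  have hℓ2 : 2 ≤ Real.log D := by
    have h : Real.exp 2 ≤ D :=
      le_trans (Nat.le_ceil _) (by exact_mod_cast le_trans (le_max_right _ _) hD)
    exact (Real.le_log_iff_exp_le (lt_of_lt_of_le (Real.exp_pos _) h)).mpr h
  have hfrakP : 0 ≤ frakP D := by
    rw [Skeleton.frakP_eq_sum_primeWindow]; exact Finset.sum_nonneg fun p _ => Nat.cast_nonneg p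
  simp only [Skeleton.bigP, Skeleton.ell]
  set ℓ : ℝ := Real.log D with hℓdef
  set Q : ℝ := Real.exp (ℓ ^ 9) ^ 2 with hQ
  have hℓ0 : 0 < ℓ := by linarith
  have hQ0 : 0 < Q := by positivity
  -- from `|𝔓 − Qℓ⁻⁷⁷| ≤ 3ℓ⁻⁶⁸·Qℓ⁻⁷⁷`: `𝔓 ≥ (1 − 3ℓ⁻⁶⁸)Qℓ⁻⁷⁷ ≥ Qℓ⁻⁷⁷/2`
  have h68 : 3 * (ℓ ^ 68)⁻¹ ≤ 1 / 2 := by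
    rw [← one_div, mul_one_div, div_le_div_iff₀ (by positivity) (by norm_num)]
    have : (2 : ℝ) ^ 68 ≤ ℓ ^ 68 := pow_le_pow_left₀ (by norm_num) hℓ2 68
    nlinarith
  have hM0 : 0 ≤ Q * (ℓ ^ 77)⁻¹ := by positivity
  have hlow : Q * (ℓ ^ 77)⁻¹ ≤ 2 * frakP D := by
    have h1 := (abs_le.mp hb).1
    nlinarith [mul_le_mul_of_nonneg_right h68 hM0]
  -- `Qℓ⁻¹⁹⁹³ = Qℓ⁻⁷⁷·ℓ⁻¹⁹¹⁶ ≤ 2𝔓ℓ⁻¹⁹¹⁶ ≤ 2𝔓ℓ⁻¹⁹⁰⁹`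
  have h1916 : (ℓ ^ 1916)⁻¹ ≤ (ℓ ^ 1909)⁻¹ :=
    inv_anti₀ (by positivity) (pow_le_pow_right₀ (by linarith) (by norm_num))
  calc Q * (ℓ ^ 1993)⁻¹ = Q * (ℓ ^ 77)⁻¹ * (ℓ ^ 1916)⁻¹ := by
        rw [mul_assoc, ← mul_inv, ← pow_add]
    _ ≤ 2 * frakP D * (ℓ ^ 1916)⁻¹ := by gcongr
    _ ≤ 2 * frakP D * (ℓ ^ 1909)⁻¹ := by gcongr

/-! ## Lemma 3.5 from its second moment -/

/-- **§3 p.15 «Thus we conclude Lemma 3.5»** (tex L828–839): under (A), the second-moment bound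
`Σ_{ψ∈Ψ}(|X₃(P²,ψ)| + ∫_{D⁴}^{P²}|X₃(x,ψ)|dx/x)² ≪ P²𝓛⁻¹⁹⁹³` together with `P²𝓛⁻¹⁹⁹³ ≪ 𝔓𝓛⁻¹⁹⁰⁹`
(the CLAIMs `Section3.Step3u021a`, `Step3u021b` of `TypedSection03`, written out) implies
`Skeleton.Lemma35`: (3.5) fails for at most `CC′𝔓𝓛^{−1909+2·585} = CC′𝔓𝓛⁻⁷³⁹` characters.
Kernel-checked. [cite: Zhang2022LandauSiegel, §3 Lemma 3.5 p.15] -/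
theorem lemma35_of_moment
    (ha : ∃ C : ℝ, Skeleton.ForAllLarge fun D _ χ => Skeleton.AssumptionA D χ →
      ∑ᶠ x : Skeleton.Chr D,
        (‖Skeleton.X3 χ x (Skeleton.bigP D ^ 2)‖
          + ∫ y in (D : ℝ) ^ 4..Skeleton.bigP D ^ 2, ‖Skeleton.X3 χ x y‖ / y) ^ 2
        ≤ C * Skeleton.bigP D ^ 2 * (Skeleton.ell D ^ 1993)⁻¹)
    (hb : ∃ C : ℝ, ∃ D₀ : ℕ, ∀ D : ℕ, D₀ ≤ D →
      Skeleton.bigP D ^ 2 * (Skeleton.ell D ^ 1993)⁻¹ ≤ C * frakP D * (Skeleton.ell D ^ 1909)⁻¹) :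
    Skeleton.Lemma35 := by
  obtain ⟨C, D₀, hD₀⟩ := ha
  obtain ⟨C', D₁, hD₁⟩ := hb
  refine ⟨max C 0 * C', max (max D₀ D₁) 3, fun D _ χ hD hq hp hA => ?_⟩
  have hD0 : D₀ ≤ D := le_trans (le_trans (le_max_left _ _) (le_max_left _ _)) hD
  have hD1 : D₁ ≤ D := le_trans (le_trans (le_max_right _ _) (le_max_left _ _)) hD
  have hmom := hD₀ D χ hD0 hq hp hA
  have hpar := hD₁ D hD1
  have hℓ : 0 < Skeleton.ell D := lt_of_lt_of_le one_pos (one_le_ell (le_trans (le_max_right _ _) hD))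
  have hV : 0 < (Skeleton.ell D ^ 585)⁻¹ := by positivity
  -- strengthen the moment bound to a non-negative constant and chain the parameter step
  have hQ0 : 0 ≤ Skeleton.bigP D ^ 2 * (Skeleton.ell D ^ 1993)⁻¹ := by positivity
  have hmom' : ∑ᶠ x : Skeleton.Chr D,
      (‖Skeleton.X3 χ x (Skeleton.bigP D ^ 2)‖
        + ∫ y in (D : ℝ) ^ 4..Skeleton.bigP D ^ 2, ‖Skeleton.X3 χ x y‖ / y) ^ 2
      ≤ max C 0 * C' * frakP D * (Skeleton.ell D ^ 1909)⁻¹ := by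
    calc _ ≤ C * Skeleton.bigP D ^ 2 * (Skeleton.ell D ^ 1993)⁻¹ := hmom
      _ ≤ max C 0 * (Skeleton.bigP D ^ 2 * (Skeleton.ell D ^ 1993)⁻¹) := by
          rw [mul_assoc]; exact mul_le_mul_of_nonneg_right (le_max_left _ _) hQ0
      _ ≤ max C 0 * (C' * frakP D * (Skeleton.ell D ^ 1909)⁻¹) :=
          mul_le_mul_of_nonneg_left hpar (le_max_right _ _)
      _ = max C 0 * C' * frakP D * (Skeleton.ell D ^ 1909)⁻¹ := by ring
  have key := ncard_not_lt_le_of_finsum_sq_le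
    (fun x : Skeleton.Chr D => ‖Skeleton.X3 χ x (Skeleton.bigP D ^ 2)‖
      + ∫ y in (D : ℝ) ^ 4..Skeleton.bigP D ^ 2, ‖Skeleton.X3 χ x y‖ / y) hV hmom'
  have hset : {x : Skeleton.Chr D | ¬ Skeleton.Ineq35 χ x} =
      {x | ¬ (‖Skeleton.X3 χ x (Skeleton.bigP D ^ 2)‖
        + ∫ y in (D : ℝ) ^ 4..Skeleton.bigP D ^ 2, ‖Skeleton.X3 χ x y‖ / y
          < (Skeleton.ell D ^ 585)⁻¹)} := rfl
  rw [hset]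
  refine key.trans (le_of_eq ?_)
  have hℓ0 : Skeleton.ell D ≠ 0 := hℓ.ne'
  field_simp

/-! ## Lemma 3.6 from its second moment -/

/-- **§3 p.16 «Thus we conclude Lemma 3.6»** (tex L854–866): under (A), the second-moment bound
`Σ_{ψ∈Ψ}(|X₄(D⁸,ψ)| + ∫_{D⁴}^{D⁸}|X₄(x,ψ)|dx/x)² ≪ 𝔓𝓛⁻²⁰⁰⁵` (the CLAIM `Section3.Step3u025` of
`TypedSection03`, written out) implies `Skeleton.Lemma36`: (3.6) fails for at most
`C𝔓𝓛^{−2005+2·633} = C𝔓𝓛⁻⁷³⁹` characters, same `C`. Kernel-checked.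
[cite: Zhang2022LandauSiegel, §3 Lemma 3.6 p.16] -/
theorem lemma36_of_moment
    (h : ∃ C : ℝ, Skeleton.ForAllLarge fun D _ χ => Skeleton.AssumptionA D χ →
      ∑ᶠ x : Skeleton.Chr D,
        (‖Skeleton.X4 χ x ((D : ℝ) ^ 8)‖
          + ∫ y in (D : ℝ) ^ 4..(D : ℝ) ^ 8, ‖Skeleton.X4 χ x y‖ / y) ^ 2
        ≤ C * frakP D * (Skeleton.ell D ^ 2005)⁻¹) :
    Skeleton.Lemma36 := by
  obtain ⟨C, D₀, hD₀⟩ := h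
  refine ⟨C, max D₀ 3, fun D _ χ hD hq hp hA => ?_⟩
  have hmom := hD₀ D χ (le_trans (le_max_left _ _) hD) hq hp hA
  have hℓ : 0 < Skeleton.ell D := lt_of_lt_of_le one_pos (one_le_ell (le_trans (le_max_right _ _) hD))
  have hV : 0 < (Skeleton.ell D ^ 633)⁻¹ := by positivity
  have key := ncard_not_lt_le_of_finsum_sq_le
    (fun x : Skeleton.Chr D => ‖Skeleton.X4 χ x ((D : ℝ) ^ 8)‖
      + ∫ y in (D : ℝ) ^ 4..(D : ℝ) ^ 8, ‖Skeleton.X4 χ x y‖ / y) hV hmom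
  have hset : {x : Skeleton.Chr D | ¬ Skeleton.Ineq36 χ x} =
      {x | ¬ (‖Skeleton.X4 χ x ((D : ℝ) ^ 8)‖
        + ∫ y in (D : ℝ) ^ 4..(D : ℝ) ^ 8, ‖Skeleton.X4 χ x y‖ / y
          < (Skeleton.ell D ^ 633)⁻¹)} := rfl
  rw [hset]
  refine key.trans (le_of_eq ?_)
  have hℓ0 : Skeleton.ell D ≠ 0 := hℓ.ne'
  field_simp


/-! ## Wave-2b: discharges of `TypedSection03` nodes by name -/

section Discharges

open scoped LSeries.notation ArithmeticFunction.Moebius ArithmeticFunction.zeta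
open Filter Topology
open Literature.NumberTheory.LFunctions.DirichletAbel (reChar reChar_one abs_reChar_le_one)

variable {D : ℕ} [NeZero D] (χ : DirichletCharacter ℂ D)

/-- `Z22:Lem3.4` deduction node («Thus we conclude», §3 p.15 tex L821): `Ded34` holds — the second
moment `Step3u019` implies `Skeleton.Lemma34` (`lemma34_of_moment`).
[cite: Zhang2022LandauSiegel, §3 Lemma 3.4 p.15] -/
theorem ded34_holds : Ded34 := lemma34_of_moment

/-- `Z22:Lem3.5` deduction node (§3 p.15 tex L839): `Ded35` holds (`lemma35_of_moment`).
[cite: Zhang2022LandauSiegel, §3 Lemma 3.5 p.15] -/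
theorem ded35_holds : Ded35 := lemma35_of_moment

/-- `Z22:Lem3.6` deduction node (§3 p.16 tex L866): `Ded36` holds (`lemma36_of_moment`).
[cite: Zhang2022LandauSiegel, §3 Lemma 3.6 p.16] -/
theorem ded36_holds : Ded36 := lemma36_of_moment

/-- `Z22:§3.u021` (b), the parameter step «`P²𝓛⁻¹⁹⁹³ ≪ 𝔓𝓛⁻¹⁹⁰⁹`» [Z22 p.15, tex L837]:
`Step3u021b` holds (`bigP_sq_le_frakP`, constant `2`). [cite: Zhang2022LandauSiegel, §3 p.15] -/
theorem step3u021b_holds : Step3u021b := bigP_sq_le_frakP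

/-- `Z22:§3.u001`, second identity [Z22 p.12, tex L707]: for `σ > 1`,
`Σ_n υ(n)n⁻ˢ = ζ(s)⁻¹L(s,χ)⁻¹`, where `υ = μ ∗ χμ` (`Skeleton.ups`): `L(μ,s)ζ(s) = 1` and
`L(χμ,s)L(χ,s) = 1` (Mathlib `LSeries_one_mul_Lseries_moebius`,
`DirichletCharacter.LSeries.mul_mu_eq_one`) and `L(f ∗ g) = L(f)L(g)`.
[cite: Zhang2022LandauSiegel, §3 p.12] -/
theorem step3u001_ups {s : ℂ} (hs : 1 < s.re) :
    L (Skeleton.ups χ) s = (riemannZeta s)⁻¹ * (χ.LFunction s)⁻¹ := by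
  have hμ : LSeriesSummable ↗μ s := ArithmeticFunction.LSeriesSummable_moebius_iff.mpr hs
  have hχμ : LSeriesSummable (↗χ * ↗μ) s := DirichletCharacter.LSeriesSummable_mul χ hμ
  have h2 : (fun n : ℕ => (ArithmeticFunction.moebius n : ℂ) * χ (n : ZMod D)) = ↗χ * ↗μ := by
    funext n; simp [mul_comm]
  have hups : Skeleton.ups χ = ↗μ ⍟ (↗χ * ↗μ) := by
    rw [Skeleton.ups, h2]
  rw [hups, LSeries_convolution' hμ hχμ]
  have hzeta : L ↗μ s = (riemannZeta s)⁻¹ := by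
    have := LSeries_one_mul_Lseries_moebius hs
    rw [LSeries_one_eq_riemannZeta hs] at this
    exact eq_inv_of_mul_eq_one_right this
  have hL : L (↗χ * ↗μ) s = (χ.LFunction s)⁻¹ := by
    have := DirichletCharacter.LSeries.mul_mu_eq_one χ hs
    rw [← DirichletCharacter.LFunction_eq_LSeries χ hs] at this
    exact eq_inv_of_mul_eq_one_right this
  rw [hzeta, hL]

/-- `Z22:§3.u001` [Z22 p.12, tex L704–707] «for `σ > 1`, `Σ ν(n)n⁻ˢ = ζ(s)L(s,χ)` and
`Σ υ(n)n⁻ˢ = ζ(s)⁻¹L(s,χ)⁻¹`»: `Step3u001 χ` holds (DISCHARGED; `step3u001_nu` of `TypedSection03`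
and `step3u001_ups`). [cite: Zhang2022LandauSiegel, §3 p.12] -/
theorem step3u001_holds : Step3u001 χ := fun _ hs => ⟨step3u001_nu χ hs, step3u001_ups χ hs⟩

/-- `Step3u001` — `_holds` alias of `step3u001_holds` above under the fact's exact name (appended
2026-08-28, D-0026 bookkeeping: the proof term is the existing theorem of this file; no statement,
definition or attribute is edited; no new named fact; the ledger's debt table listed the fact
unproved). [cite: Zhang2022LandauSiegel, §3 p.12] -/
theorem _root_.Literature.NumberTheory.LFunctions.Zhang2022.Section3.Step3u001_holds :
    Step3u001 χ :=
  _root_.Literature.NumberTheory.LFunctions.Zhang2022.Section3.step3u001_holds (χ := χ)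

omit [NeZero D] in
/-- `Z22:(3.1)` [Z22 p.12, (3.1), tex L709] «`|υ(n)| ≤ ν(n) ≤ τ₂(n)`» (with `ν(n)` real): `Eq31 χ`
holds for the real character of the setting — the hypothesis `χ² = 1` is the manuscript's standing
assumption (§2: `χ` a real primitive character mod `D`), made explicit. Left half: tree
`abs_upsilonOf_le_nuOf` through the bridges `Skeleton.nu_eq_ofReal_nuOf`/`ups_eq_ofReal_upsilonOf`;
right half: `eq31_right`. [cite: Zhang2022LandauSiegel, §3 (3.1) p.12] -/
theorem eq31_holds (hχ : χ ^ 2 = 1) : Eq31 χ := by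
  intro n
  refine ⟨Lemma31.divisorSumChar_im_eq_zero χ hχ n, ?_, eq31_right χ n⟩
  rw [Skeleton.ups_eq_ofReal_upsilonOf χ hχ, Skeleton.nu_eq_ofReal_nuOf χ hχ, Complex.norm_real,
    Complex.ofReal_re, Real.norm_eq_abs]
  exact abs_upsilonOf_le_nuOf (reChar χ) (Lemma36Input.reChar_mul_all χ hχ) (reChar_one χ)
    (abs_reChar_le_one χ) n

/-- `ζ(1+s) = 1/s + O(1)`: there is `r0 > 0` with `‖ζ(1+s)‖ ≤ 2/‖s‖` for `0 < ‖s‖ < r0`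
(Mathlib's `riemannZeta_residue_one`). [folklore] -/
private theorem norm_zeta_one_add_le_near_zero :
    ∃ r0 : ℝ, 0 < r0 ∧ ∀ s : ℂ, s ≠ 0 → ‖s‖ < r0 → ‖riemannZeta (1 + s)‖ ≤ 2 / ‖s‖ := by
  have h := riemannZeta_residue_one
  rw [Metric.tendsto_nhdsWithin_nhds] at h
  obtain ⟨r0, hδ, hz⟩ := h 1 one_pos
  refine ⟨r0, hδ, fun s hs hsδ => ?_⟩
  have hmem : (1 + s) ∈ ({1}ᶜ : Set ℂ) := by
    simp only [Set.mem_compl_iff, Set.mem_singleton_iff, add_eq_left]; exact hs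
  have hdist : dist (1 + s) 1 < r0 := by rw [dist_eq_norm, add_sub_cancel_left]; exact hsδ
  have key := hz hmem hdist
  rw [dist_eq_norm, add_sub_cancel_left] at key
  have hs0 : 0 < ‖s‖ := norm_pos_iff.mpr hs
  have h2 : ‖s * riemannZeta (1 + s)‖ ≤ 2 := by
    have := norm_sub_norm_le (s * riemannZeta (1 + s)) 1
    rw [norm_one] at this; linarith
  rw [norm_mul] at h2
  rw [le_div_iff₀ hs0, mul_comm]; exact h2

/-- `Γ` is continuous at `1` with `Γ(1) = 1`: there is `r0 > 0` with `‖Γ(w)‖ ≤ 2` for `‖w − 1‖ < r0`.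
[folklore] -/
private theorem norm_Gamma_le_two_near_one :
    ∃ r0 : ℝ, 0 < r0 ∧ ∀ w : ℂ, ‖w - 1‖ < r0 → ‖Complex.Gamma w‖ ≤ 2 := by
  have hd : DifferentiableAt ℂ Complex.Gamma 1 :=
    Complex.differentiableAt_Gamma 1 (fun m => by
      intro h
      have := congrArg Complex.re h
      simp at this
      linarith)
  have hc := hd.continuousAt
  rw [Metric.continuousAt_iff] at hc
  obtain ⟨r0, hδ, h⟩ := hc 1 one_pos
  refine ⟨r0, hδ, fun w hw => ?_⟩
  have key := h (by rwa [dist_eq_norm])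
  rw [Complex.Gamma_one, dist_eq_norm] at key
  have := norm_sub_norm_le (Complex.Gamma w) 1
  rw [norm_one] at this; linarith

/-- For `x > 0` real, `(x : ℂ)^z = exp(z log x)` with the REAL logarithm. [folklore] -/
private theorem ofReal_cpow_eq_exp_log {x : ℝ} (hx : 0 < x) (z : ℂ) :
    ((x : ℝ) : ℂ) ^ z = Complex.exp (z * (Real.log x : ℝ)) := by
  rw [Complex.cpow_def_of_ne_zero (Complex.ofReal_ne_zero.mpr hx.ne'), Complex.ofReal_log hx.le,
    mul_comm]

/-- `‖e^a − e^b‖ ≤ 6(‖a‖ + ‖b‖)` when `‖a‖, ‖b‖ ≤ 1/2`. [folklore] -/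
private theorem norm_exp_sub_exp_le_of_half {a b : ℂ} (ha : ‖a‖ ≤ 1 / 2) (hb : ‖b‖ ≤ 1 / 2) :
    ‖Complex.exp a - Complex.exp b‖ ≤ 6 * (‖a‖ + ‖b‖) := by
  have hab : ‖a - b‖ ≤ 1 := by
    have := norm_sub_le a b; linarith
  have h1 : Complex.exp a - Complex.exp b = Complex.exp b * (Complex.exp (a - b) - 1) := by
    rw [mul_sub, mul_one, ← Complex.exp_add, add_sub_cancel]
  have h2 : ‖Complex.exp b‖ ≤ 3 := by
    rw [Complex.norm_exp]
    have hre : b.re ≤ 1 := le_trans (Complex.re_le_norm b) (by linarith)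
    have := Real.exp_le_exp.mpr hre
    have he : Real.exp 1 < 3 := lt_trans Real.exp_one_lt_d9 (by norm_num)
    linarith
  have h3 : ‖Complex.exp (a - b) - 1‖ ≤ 2 * ‖a - b‖ := Complex.norm_exp_sub_one_le hab
  rw [h1, norm_mul]
  calc ‖Complex.exp b‖ * ‖Complex.exp (a - b) - 1‖ ≤ 3 * (2 * ‖a - b‖) := by
        gcongr
    _ ≤ 3 * (2 * (‖a‖ + ‖b‖)) := by gcongr; exact norm_sub_le a b
    _ = 6 * (‖a‖ + ‖b‖) := by ring

/-- **The two estimates of `Z22:§3.u009` on the circle `|s| = α* = 𝓛⁻²⁰²⁴`** (core form):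
eventually in `D`, for `‖s‖ = 𝓛⁻²⁰²⁴`, `‖ζ(1+s)‖ ≤ 2𝓛²⁰²⁴` and `‖(P^{2s} − D^{4s})Γ(s)‖ ≤ 72𝓛⁹`
(`P = e^{𝓛⁹}`: `P^{2s} − D^{4s} = e^{2s𝓛⁹} − e^{4s𝓛}` has norm `≤ 6|s|(2𝓛⁹ + 4𝓛)`, and
`Γ(s) = Γ(s+1)/s` with `‖Γ(s+1)‖ ≤ 2`). [cite: Zhang2022LandauSiegel, §3 p.13] -/
theorem step3u009_core :
    ∃ D₀ : ℕ, ∀ D : ℕ, D₀ ≤ D → ∀ s : ℂ, ‖s‖ = (Skeleton.ell D ^ 2024)⁻¹ →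
      ‖riemannZeta (1 + s)‖ ≤ 72 * Skeleton.ell D ^ 2024 ∧
      ‖(((Skeleton.bigP D : ℝ) : ℂ) ^ (2 * s) - ((D : ℝ) : ℂ) ^ (4 * s)) * Complex.Gamma s‖ ≤
        72 * Skeleton.ell D ^ 9 := by
  obtain ⟨δ₁, hδ₁, hζ⟩ := norm_zeta_one_add_le_near_zero
  obtain ⟨δ₂, hδ₂, hΓ⟩ := norm_Gamma_le_two_near_one
  set M : ℝ := max 2 (max (1 / δ₁ + 1) (1 / δ₂ + 1)) with hM
  refine ⟨⌈Real.exp M⌉₊, fun D hD s hs => ?_⟩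
  -- `ℓ = log D ≥ M`
  have hℓM : M ≤ Skeleton.ell D := by
    have h : Real.exp M ≤ D := le_trans (Nat.le_ceil _) (by exact_mod_cast hD)
    exact (Real.le_log_iff_exp_le (lt_of_lt_of_le (Real.exp_pos _) h)).mpr h
  set ℓ : ℝ := Skeleton.ell D with hℓdef
  have hℓ2 : 2 ≤ ℓ := le_trans (le_max_left _ _) hℓM
  have hℓ1 : 1 ≤ ℓ := by linarith
  have hℓ0 : 0 < ℓ := by linarith
  have hD0 : (0 : ℝ) < D := by
    have : Real.exp M ≤ D := le_trans (Nat.le_ceil _) (by exact_mod_cast hD)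
    exact lt_of_lt_of_le (Real.exp_pos _) this
  -- `‖s‖ = ℓ⁻²⁰²⁴ ≤ ℓ⁻¹ < δ₁, δ₂`, and `s ≠ 0`
  have hpow : ℓ ≤ ℓ ^ 2024 := le_self_pow₀ hℓ1 (by norm_num)
  have hsle : ‖s‖ ≤ ℓ⁻¹ := by rw [hs]; exact inv_anti₀ hℓ0 hpow
  have hs0 : s ≠ 0 := by
    rw [← norm_pos_iff, hs]; positivity
  have hsδ₁ : ‖s‖ < δ₁ := by
    have h1 : 1 / δ₁ + 1 ≤ ℓ := le_trans (le_trans (le_max_left _ _) (le_max_right _ _)) hℓM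
    have h2 : ℓ⁻¹ < δ₁ := by
      rw [inv_lt_comm₀ hℓ0 hδ₁, ← one_div]; linarith
    exact lt_of_le_of_lt hsle h2
  have hsδ₂ : ‖s‖ < δ₂ := by
    have h1 : 1 / δ₂ + 1 ≤ ℓ := le_trans (le_trans (le_max_right _ _) (le_max_right _ _)) hℓM
    have h2 : ℓ⁻¹ < δ₂ := by
      rw [inv_lt_comm₀ hℓ0 hδ₂, ← one_div]; linarith
    exact lt_of_le_of_lt hsle h2
  refine ⟨?_, ?_⟩
  · -- `‖ζ(1+s)‖ ≤ 2/‖s‖ = 2ℓ²⁰²⁴ ≤ 72ℓ²⁰²⁴`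
    calc ‖riemannZeta (1 + s)‖ ≤ 2 / ‖s‖ := hζ s hs0 hsδ₁
      _ = 2 * ℓ ^ 2024 := by rw [hs, div_inv_eq_mul]
      _ ≤ 72 * ℓ ^ 2024 := by gcongr; norm_num
  · -- the powers as exponentials
    have hP : ((Skeleton.bigP D : ℝ) : ℂ) ^ (2 * s) = Complex.exp (2 * s * (ℓ ^ 9 : ℝ)) := by
      rw [Skeleton.bigP, ofReal_cpow_eq_exp_log (Real.exp_pos _), Real.log_exp]
    have hDpow : ((D : ℝ) : ℂ) ^ (4 * s) = Complex.exp (4 * s * (ℓ : ℂ)) := by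
      rw [ofReal_cpow_eq_exp_log hD0, hℓdef, Skeleton.ell]
    set a : ℂ := 2 * s * (ℓ ^ 9 : ℝ) with ha
    set b : ℂ := 4 * s * (ℓ : ℂ) with hb
    have hna : ‖a‖ = 2 * ‖s‖ * ℓ ^ 9 := by
      rw [ha, norm_mul, norm_mul, Complex.norm_real, Real.norm_of_nonneg (by positivity),
        Complex.norm_two]
    have hnb : ‖b‖ = 4 * ‖s‖ * ℓ := by
      rw [hb, norm_mul, norm_mul, Complex.norm_real, Real.norm_of_nonneg hℓ0.le]
      norm_num
    -- `‖a‖ = 2ℓ⁹/ℓ²⁰²⁴ ≤ 1/2`, `‖b‖ = 4ℓ/ℓ²⁰²⁴ ≤ 1/2`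
    have h4a : (4 : ℝ) ≤ ℓ ^ 2015 :=
      calc (4 : ℝ) = 2 ^ 2 := by norm_num
        _ ≤ 2 ^ 2015 := pow_le_pow_right₀ (by norm_num) (by norm_num)
        _ ≤ ℓ ^ 2015 := pow_le_pow_left₀ (by norm_num) hℓ2 2015
    have h8b : (8 : ℝ) ≤ ℓ ^ 2023 :=
      calc (8 : ℝ) = 2 ^ 3 := by norm_num
        _ ≤ 2 ^ 2023 := pow_le_pow_right₀ (by norm_num) (by norm_num)
        _ ≤ ℓ ^ 2023 := pow_le_pow_left₀ (by norm_num) hℓ2 2023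
    have ha' : ‖a‖ ≤ 1 / 2 := by
      rw [hna, hs]
      have heq : 2 * (ℓ ^ 2024)⁻¹ * ℓ ^ 9 = 2 * (ℓ ^ 2015)⁻¹ := by
        have : ℓ ^ 2024 = ℓ ^ 9 * ℓ ^ 2015 := by rw [← pow_add]
        rw [this]; field_simp
      rw [heq]
      have : (ℓ ^ 2015)⁻¹ ≤ 4⁻¹ := inv_anti₀ (by norm_num) h4a
      linarith
    have hb' : ‖b‖ ≤ 1 / 2 := by
      rw [hnb, hs]
      have heq : 4 * (ℓ ^ 2024)⁻¹ * ℓ = 4 * (ℓ ^ 2023)⁻¹ := by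
        have : ℓ ^ 2024 = ℓ * ℓ ^ 2023 := by rw [← pow_succ']
        rw [this]; field_simp
      rw [heq]
      have : (ℓ ^ 2023)⁻¹ ≤ 8⁻¹ := inv_anti₀ (by norm_num) h8b
      linarith
    have hdiff : ‖Complex.exp a - Complex.exp b‖ ≤ 6 * ((2 * ℓ ^ 9 + 4 * ℓ) * ‖s‖) := by
      refine (norm_exp_sub_exp_le_of_half ha' hb').trans (le_of_eq ?_)
      rw [hna, hnb]; ring
    -- `Γ(s) = Γ(s+1)/s`, `‖Γ(s+1)‖ ≤ 2`
    have hΓs : Complex.Gamma s = Complex.Gamma (s + 1) / s := by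
      rw [Complex.Gamma_add_one s hs0, mul_div_cancel_left₀ _ hs0]
    have hΓ1 : ‖Complex.Gamma (s + 1)‖ ≤ 2 := hΓ (s + 1) (by rw [add_sub_cancel_right]; exact hsδ₂)
    have hsnorm : 0 < ‖s‖ := norm_pos_iff.mpr hs0
    rw [hP, hDpow, hΓs, norm_mul, norm_div]
    calc ‖Complex.exp a - Complex.exp b‖ * (‖Complex.Gamma (s + 1)‖ / ‖s‖)
        ≤ 6 * ((2 * ℓ ^ 9 + 4 * ℓ) * ‖s‖) * (2 / ‖s‖) := by gcongr
      _ = 12 * (2 * ℓ ^ 9 + 4 * ℓ) := by field_simp; norm_num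
      _ ≤ 12 * (2 * ℓ ^ 9 + 4 * ℓ ^ 9) := by
          have : ℓ ≤ ℓ ^ 9 := le_self_pow₀ hℓ1 (by norm_num)
          nlinarith
      _ = 72 * ℓ ^ 9 := by ring

/-- `Z22:§3.u009` [Z22 p.13, tex L747–748] «If `|s| = α*`, then `ζ(1+s) ≪ 𝓛²⁰²⁴`,
`(P^{2s} − D^{4s})Γ(s) ≪ 𝓛⁹`»: `Step3u009` holds, with `C = 72` (DISCHARGED; `step3u009_core`).
[cite: Zhang2022LandauSiegel, §3 p.13] -/
theorem step3u009_holds : Step3u009 := by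
  obtain ⟨D₀, h⟩ := step3u009_core
  refine ⟨72, D₀, fun D _ χ hD _ _ _ s hs => ?_⟩
  exact h D hD s hs

end Discharges

/-! ## Wave-2c: the local factors `φ_p` (`Z22:§3.u004`, `u005`) and the bound (3.3) — kernel proofs -/

section LocalFactors

open scoped LSeries.notation ArithmeticFunction.Moebius

variable {D : ℕ} (χ : DirichletCharacter ℂ D)

/-- For `p` prime and `σ > 0`, `|p⁻ˢ| < 1`. [folklore] -/
private theorem norm_natCast_cpow_neg_lt_one {p : ℕ} (hp : p.Prime) {s : ℂ} (hs : 0 < s.re) :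
    ‖(p : ℂ) ^ (-s)‖ < 1 := by
  rw [Complex.norm_natCast_cpow_of_pos hp.pos, neg_re]
  exact Real.rpow_lt_one_of_one_lt_of_neg (by exact_mod_cast hp.one_lt) (by linarith)

/-- `‖u‖ < 1 ⇒ 1 − u ≠ 0`. [folklore] -/
private theorem one_sub_ne_zero_of_norm_lt_one' {u : ℂ} (hu : ‖u‖ < 1) : 1 - u ≠ 0 := by
  intro h
  have : u = 1 := by linear_combination -h
  rw [this, norm_one] at hu
  exact lt_irrefl _ hu

/-- `‖w‖ ≤ 1`, `‖u‖ < 1` ⇒ `‖wu‖ < 1`. [folklore] -/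
private theorem norm_mul_lt_one' {w u : ℂ} (hw : ‖w‖ ≤ 1) (hu : ‖u‖ < 1) : ‖w * u‖ < 1 := by
  rw [norm_mul]; exact mul_lt_one_of_nonneg_of_lt_one_right hw (norm_nonneg _) hu

/-- **Closed form of the local factor `φ_p`** of `Z22:§3.u003`–`u005` [Z22 p.13, tex L722–728]
(for `σ > 0`): with `w = χ(p)`, `x = p⁻ˢ`, `φ_p(s) = (1 − x)(1 − wx)(1 + wx)/(1 − w²x)`, since
`Σ_e ν(pᵉ)²xᵉ = (1 + wx)/((1 − x)(1 − wx)(1 − w²x))` (tree `hasSum_geomPartialSum_sq_mul_pow`,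
`divisorSumChar_prime_pow`). [cite: Zhang2022LandauSiegel, §3 p.13] -/
theorem phiLocal_eq {p : ℕ} (hp : p.Prime) {s : ℂ} (hs : 0 < s.re) :
    phiLocal χ p s = (1 - (p : ℂ) ^ (-s)) * (1 - χ (p : ZMod D) * (p : ℂ) ^ (-s)) *
      (1 + χ (p : ZMod D) * (p : ℂ) ^ (-s)) / (1 - χ (p : ZMod D) ^ 2 * (p : ℂ) ^ (-s)) := by
  have hx := norm_natCast_cpow_neg_lt_one hp hs
  have hw : ‖χ (p : ZMod D)‖ ≤ 1 := χ.norm_le_one _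
  have h := hasSum_geomPartialSum_sq_mul_pow hw hx
  have hterm : ∀ e : ℕ, Skeleton.nu χ (p ^ e) ^ 2 * (p : ℂ) ^ (-((e : ℂ) * s)) =
      geomPartialSum (χ (p : ZMod D)) e ^ 2 * ((p : ℂ) ^ (-s)) ^ e := by
    intro e
    unfold Skeleton.nu
    rw [divisorSumChar_prime_pow χ hp e, ← Complex.cpow_nat_mul]
    congr 2
    ring
  have htsum : ∑' e : ℕ, Skeleton.nu χ (p ^ e) ^ 2 * (p : ℂ) ^ (-((e : ℂ) * s)) =
      (1 + χ (p : ZMod D) * (p : ℂ) ^ (-s)) / ((1 - (p : ℂ) ^ (-s)) *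
        (1 - χ (p : ZMod D) * (p : ℂ) ^ (-s)) * (1 - χ (p : ZMod D) ^ 2 * (p : ℂ) ^ (-s))) := by
    simp_rw [hterm]
    exact h.tsum_eq
  have hwx : ‖χ (p : ZMod D) * (p : ℂ) ^ (-s)‖ < 1 := norm_mul_lt_one' hw hx
  have hw2x : ‖χ (p : ZMod D) ^ 2 * (p : ℂ) ^ (-s)‖ < 1 :=
    norm_mul_lt_one' (by rw [norm_pow]; exact pow_le_one₀ (norm_nonneg _) hw) hx
  have h1 := one_sub_ne_zero_of_norm_lt_one' hx
  have h2 := one_sub_ne_zero_of_norm_lt_one' hwx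
  have h3 := one_sub_ne_zero_of_norm_lt_one' hw2x
  unfold phiLocal
  rw [htsum]
  field_simp

/-- «by checking the cases `χ(p) = ±1`» [Z22 p.13, tex L726]: `χ(p)² = 1` ⇒ `φ_p(s) = 1 − p^{−2s}` EXACTLY
(`σ > 0`). [cite: Zhang2022LandauSiegel, §3 p.13] -/
theorem phiLocal_eq_of_sq_eq_one {p : ℕ} (hp : p.Prime) {s : ℂ} (hs : 0 < s.re)
    (hw : χ (p : ZMod D) ^ 2 = 1) : phiLocal χ p s = 1 - ((p : ℂ) ^ (-s)) ^ 2 := by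
  have hx := norm_natCast_cpow_neg_lt_one hp hs
  have h1 := one_sub_ne_zero_of_norm_lt_one' hx
  rw [phiLocal_eq χ hp hs, hw, one_mul]
  have : (1 - χ (p : ZMod D) * (p : ℂ) ^ (-s)) * (1 + χ (p : ZMod D) * (p : ℂ) ^ (-s)) =
      1 - ((p : ℂ) ^ (-s)) ^ 2 := by
    have e : (1 - χ (p : ZMod D) * (p : ℂ) ^ (-s)) * (1 + χ (p : ZMod D) * (p : ℂ) ^ (-s)) =
        1 - χ (p : ZMod D) ^ 2 * ((p : ℂ) ^ (-s)) ^ 2 := by ring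
    rw [e, hw, one_mul]
  rw [mul_assoc, this]
  field_simp

/-- «and `χ(p) = 0` respectively» [Z22 p.13, tex L726–728]: `χ(p) = 0` ⇒ `φ_p(s) = 1 − p⁻ˢ` EXACTLY
(`σ > 0`). [cite: Zhang2022LandauSiegel, §3 p.13] -/
theorem phiLocal_eq_of_eq_zero {p : ℕ} (hp : p.Prime) {s : ℂ} (hs : 0 < s.re)
    (hw : χ (p : ZMod D) = 0) : phiLocal χ p s = 1 - (p : ℂ) ^ (-s) := by
  rw [phiLocal_eq χ hp hs, hw]
  simp

omit χ in
/-- `Z22:§3.u004` [Z22 p.13, tex L726] «`φ_p(s) = 1 + O(p^{−2σ})` if `p ∤ D`» — DISCHARGED with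
`C = 1` (any `σ₀ > 0`): for `p ∤ D`, `χ(p)` is a unit value of a quadratic character, so `χ(p) = ±1`
and `φ_p(s) − 1 = −p^{−2s}`. [cite: Zhang2022LandauSiegel, §3 p.13] -/
theorem step3u004_holds : Step3u004 := by
  intro σ₀ hσ₀
  refine ⟨1, fun D _ χ hq p hp hpD s hs => ?_⟩
  have hs0 : 0 < s.re := lt_of_lt_of_le hσ₀ hs
  have hu : IsUnit (p : ZMod D) := (ZMod.isUnit_prime_iff_not_dvd hp).mpr hpD
  have hne : χ (p : ZMod D) ≠ 0 := by
    obtain ⟨u, hu'⟩ := hu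
    rw [← hu', ← MulChar.coe_toUnitHom]
    exact Units.ne_zero _
  have hw : χ (p : ZMod D) ^ 2 = 1 := by
    rcases hq (p : ZMod D) with h | h | h
    · exact absurd h hne
    · rw [h, one_pow]
    · rw [h]; norm_num
  rw [phiLocal_eq_of_sq_eq_one χ hp hs0 hw, sub_sub_cancel_left, norm_neg, norm_pow,
    Complex.norm_natCast_cpow_of_pos hp.pos, neg_re, one_mul, ← Real.rpow_natCast,
    ← Real.rpow_mul (Nat.cast_nonneg p)]
  norm_num
  ring_nf
  rfl

omit χ in
/-- `Z22:§3.u005` [Z22 p.13, tex L728] «`φ_p(s) = (1 − p⁻ˢ)(1 + O(p^{−2σ}))` if `p ∣ D`» —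
DISCHARGED with `C = 0`: for `p ∣ D`, `χ(p) = 0` and `φ_p(s) = 1 − p⁻ˢ` EXACTLY (the printed
`O(p^{−2σ})` is in fact zero). [cite: Zhang2022LandauSiegel, §3 p.13] -/
theorem step3u005_holds : Step3u005 := by
  intro σ₀ hσ₀
  refine ⟨0, fun D _ χ _ p hp hpD s hs => ?_⟩
  have hs0 : 0 < s.re := lt_of_lt_of_le hσ₀ hs
  have hnu : ¬ IsUnit (p : ZMod D) := fun h => (ZMod.isUnit_prime_iff_not_dvd hp).mp h hpD
  have hw : χ (p : ZMod D) = 0 := χ.map_nonunit hnu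
  rw [phiLocal_eq_of_eq_zero χ hp hs0 hw, sub_self, norm_zero]
  simp

/-- For `0 ≤ y ≤ 1/2`, `(1 − y)⁻¹ ≤ exp(2y)`. [folklore] -/
private theorem inv_one_sub_le_exp {y : ℝ} (h0 : 0 ≤ y) (h1 : y ≤ 1 / 2) :
    (1 - y)⁻¹ ≤ Real.exp (2 * y) := by
  have hpos : 0 < 1 - y := by linarith
  have hle : (1 - y)⁻¹ ≤ 1 + 2 * y := by
    rw [inv_eq_one_div, div_le_iff₀ hpos]; nlinarith
  have := Real.add_one_le_exp (2 * y)
  linarith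

omit χ in
/-- `Z22:(3.3)` [Z22 p.13, (3.3), tex L730] «`φ(s) ≪ ∏_{p∣D}|1 − p⁻ˢ|` for `σ ≥ σ₁ > 1/2`, the implied
constant depending on `σ₁`» — DISCHARGED for the continuation `φ = (ζ(2s)∏_{p∣D}(1 + p⁻ˢ))⁻¹`
(`DivisorSumCharSq.phi`), with the explicit constant `S·e^{2S}`, `S = Σ_{n≥1} n^{−2σ₁}`:
`|ζ(2s)⁻¹| = |Σ μ(n)n^{−2s}| ≤ S` (Möbius inversion, Mathlib `LSeries_one_mul_Lseries_moebius`), and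
`|1 + p⁻ˢ|⁻¹ = |1 − p⁻ˢ|/|1 − p^{−2s}| ≤ |1 − p⁻ˢ|(1 − p^{−2σ₁})⁻¹ ≤ |1 − p⁻ˢ|e^{2p^{−2σ₁}}`, the
exponents summing to `≤ 2S` uniformly in `D`. [cite: Zhang2022LandauSiegel, §3 (3.3) p.13] -/
theorem eq33_holds : Eq33 := by
  intro σ₁ hσ₁
  set t : ℝ := 2 * σ₁ with ht_def
  have ht : 1 < t := by rw [ht_def]; linarith
  have hsum : Summable fun n : ℕ => (n : ℝ) ^ (-t) := Real.summable_nat_rpow.mpr (by linarith)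
  set S : ℝ := ∑' n : ℕ, (n : ℝ) ^ (-t) with hS_def
  have hterm_nonneg : ∀ n : ℕ, 0 ≤ (n : ℝ) ^ (-t) := fun n => by positivity
  have hS1 : 1 ≤ S := by
    have h := hsum.sum_le_tsum {1} (fun n _ => hterm_nonneg n)
    simpa using h
  have hS0 : 0 < S := by linarith
  refine ⟨S * Real.exp (2 * S), fun D s hs => ?_⟩
  have hs0 : 0 < s.re := by linarith
  -- (i) `‖ζ(2s)⁻¹‖ ≤ S`
  have h2s : 1 < (2 * s).re := by simp; linarith
  have hζinv : (riemannZeta (2 * s))⁻¹ = L ↗μ (2 * s) := by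
    have h := LSeries_one_mul_Lseries_moebius h2s
    rw [LSeries_one_eq_riemannZeta h2s] at h
    exact (eq_inv_of_mul_eq_one_right h).symm
  have hζ : ‖(riemannZeta (2 * s))⁻¹‖ ≤ S := by
    rw [hζinv, LSeries]
    refine tsum_of_norm_bounded hsum.hasSum fun n => ?_
    rw [LSeries.norm_term_eq]
    split_ifs with hn
    · exact hterm_nonneg n
    · have hn1 : (1 : ℝ) ≤ n := by exact_mod_cast Nat.one_le_iff_ne_zero.mpr hn
      have hμ : ‖((μ n : ℤ) : ℂ)‖ ≤ 1 := by
        rw [Complex.norm_intCast]; exact_mod_cast ArithmeticFunction.abs_moebius_le_one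
      calc ‖((μ n : ℤ) : ℂ)‖ / (n : ℝ) ^ (2 * s).re ≤ 1 / (n : ℝ) ^ (2 * s).re := by
            gcongr
        _ = (n : ℝ) ^ (-(2 * s).re) := by rw [Real.rpow_neg (by positivity), one_div]
        _ ≤ (n : ℝ) ^ (-t) := by
            apply Real.rpow_le_rpow_of_exponent_le hn1
            simp; rw [ht_def]; linarith
  -- (ii) per-prime bound `‖(1 + p⁻ˢ)⁻¹‖ ≤ exp(2p^{-t}) ‖1 − p⁻ˢ‖`
  have hp_bound : ∀ p ∈ D.primeFactors,
      ‖(1 + (p : ℂ) ^ (-s))⁻¹‖ ≤ Real.exp (2 * (p : ℝ) ^ (-t)) * ‖1 - (p : ℂ) ^ (-s)‖ := by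
    intro p hp
    have hpp : p.Prime := Nat.prime_of_mem_primeFactors hp
    set x : ℂ := (p : ℂ) ^ (-s) with hx_def
    have hxn : ‖x‖ = (p : ℝ) ^ (-s.re) := by
      rw [hx_def, Complex.norm_natCast_cpow_of_pos hpp.pos, neg_re]
    have hp2 : (2 : ℝ) ≤ p := by exact_mod_cast hpp.two_le
    have hp1 : (1 : ℝ) ≤ p := by linarith
    -- `‖x‖² ≤ p^{-t} ≤ 1/2`
    have hx2 : ‖x‖ ^ 2 ≤ (p : ℝ) ^ (-t) := by
      rw [hxn, ← Real.rpow_natCast, ← Real.rpow_mul (by linarith)]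
      apply Real.rpow_le_rpow_of_exponent_le hp1
      push_cast; rw [ht_def]; linarith
    have hpt : (p : ℝ) ^ (-t) ≤ 1 / 2 := by
      calc (p : ℝ) ^ (-t) ≤ (p : ℝ) ^ (-1 : ℝ) := Real.rpow_le_rpow_of_exponent_le hp1 (by linarith)
        _ = 1 / p := by rw [Real.rpow_neg_one, one_div]
        _ ≤ 1 / 2 := by gcongr
    have hpt0 : 0 ≤ (p : ℝ) ^ (-t) := by positivity
    -- `‖1 − x²‖ ≥ 1 − p^{-t} > 0`
    have hlow : 1 - (p : ℝ) ^ (-t) ≤ ‖1 - x ^ 2‖ := by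
      have h := norm_sub_norm_le (1 : ℂ) (x ^ 2)
      rw [norm_one, norm_pow] at h
      linarith
    have hlow_pos : 0 < 1 - (p : ℝ) ^ (-t) := by linarith
    have hne : 1 - x ^ 2 ≠ 0 := fun h => by rw [h, norm_zero] at hlow; linarith
    -- `(1 + x)⁻¹ = (1 − x)/(1 − x²)`
    have hid : (1 + x)⁻¹ = (1 - x) / (1 - x ^ 2) := by
      have h1x : 1 + x ≠ 0 := by
        intro h
        apply hne
        have : x = -1 := by linear_combination h
        rw [this]; ring
      field_simp
      ring
    rw [hid, norm_div]
    calc ‖1 - x‖ / ‖1 - x ^ 2‖ ≤ ‖1 - x‖ / (1 - (p : ℝ) ^ (-t)) := by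
          gcongr
      _ = (1 - (p : ℝ) ^ (-t))⁻¹ * ‖1 - x‖ := by rw [div_eq_inv_mul]
      _ ≤ Real.exp (2 * (p : ℝ) ^ (-t)) * ‖1 - x‖ := by
          gcongr
          exact inv_one_sub_le_exp hpt0 hpt
  -- (iii) assemble
  rw [DivisorSumCharSq.phi_def, mul_inv, norm_mul, ← Finset.prod_inv_distrib, norm_prod]
  have hprod : ∏ p ∈ D.primeFactors, ‖(1 + (p : ℂ) ^ (-s))⁻¹‖ ≤
      ∏ p ∈ D.primeFactors, (Real.exp (2 * (p : ℝ) ^ (-t)) * ‖1 - (p : ℂ) ^ (-s)‖) :=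
    Finset.prod_le_prod (fun p _ => norm_nonneg _) hp_bound
  rw [Finset.prod_mul_distrib, ← Real.exp_sum, ← Finset.mul_sum] at hprod
  have hexp : Real.exp (2 * ∑ p ∈ D.primeFactors, (p : ℝ) ^ (-t)) ≤ Real.exp (2 * S) := by
    gcongr
    exact hsum.sum_le_tsum D.primeFactors (fun n _ => hterm_nonneg n)
  have hP0 : 0 ≤ ∏ p ∈ D.primeFactors, ‖1 - (p : ℂ) ^ (-s)‖ :=
    Finset.prod_nonneg fun p _ => norm_nonneg _
  calc ‖(riemannZeta (2 * s))⁻¹‖ * ∏ p ∈ D.primeFactors, ‖(1 + (p : ℂ) ^ (-s))⁻¹‖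
      ≤ S * (Real.exp (2 * ∑ p ∈ D.primeFactors, (p : ℝ) ^ (-t)) *
          ∏ p ∈ D.primeFactors, ‖1 - (p : ℂ) ^ (-s)‖) := by
        gcongr
    _ ≤ S * (Real.exp (2 * S) * ∏ p ∈ D.primeFactors, ‖1 - (p : ℂ) ^ (-s)‖) := by
        gcongr
    _ = S * Real.exp (2 * S) * ∏ p ∈ D.primeFactors, ‖1 - (p : ℂ) ^ (-s)‖ := by ring

end LocalFactors

/-! ## Wave-2d: the Euler product (`u003`), the smoothing step and the Mellin identity (`u006`) -/

section EulerMellin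

open MeasureTheory Filter Topology
open scoped LSeries.notation
open Literature.NumberTheory.LFunctions.DivisorSumCharSq (W)

variable {D : ℕ} [NeZero D] (χ : DirichletCharacter ℂ D)

/-- `Z22:§3.u003` [Z22 p.13, tex L722] «which has the Euler product representation `φ(s) = ∏_p φ_p(s)`»
(`σ > 1`): `Step3u003 χ` holds (DISCHARGED) — `Σ ν(n)²n⁻ˢ = ∏_p Σ_e ν(pᵉ)²p^{−es}` (Mathlib
`EulerProduct.eulerProduct_hasProd`; `ν` multiplicative, summable by the divisor bound, as in the tree's
`LSeries_divisorSumChar_sq_mul_LSeries`), `∏_p(1 − p⁻ˢ) → ζ(s)⁻¹` and `∏_p(1 − χ(p)p⁻ˢ) → L(s,χ)⁻¹`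
(`riemannZeta_eulerProduct_hasProd`, `DirichletCharacter.LSeries_eulerProduct_hasProd`, inverted by
`Tendsto.inv₀` since `ζ(s)L(s,χ) ≠ 0` for `σ > 1`). [cite: Zhang2022LandauSiegel, §3 p.13] -/
theorem step3u003_holds : Step3u003 χ := by
  intro s hs
  have hs0 : s ≠ 0 := by
    rintro rfl
    rw [Complex.zero_re] at hs
    linarith
  have hs1 : s ≠ 1 := fun h => by simp [h] at hs
  -- (i) the Euler product of `Σ ν(n)² n⁻ˢ` (as in the tree's `LSeries_divisorSumChar_sq_mul_LSeries`)
  set F : ℕ → ℂ := fun n => Skeleton.nu χ n ^ 2 * riemannZetaSummandHom hs0 n with hF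
  have hFx : ∀ n, riemannZetaSummandHom hs0 n = (n : ℂ) ^ (-s) := fun n => rfl
  have hFterm : ∀ n, F n = LSeries.term (fun n => Skeleton.nu χ n ^ 2) s n := by
    intro n
    rw [LSeries.term_def₀ (by simp [Skeleton.nu]) s n]
    rfl
  have hF0 : F 0 = 0 := by simp [hF, Skeleton.nu]
  have hF1 : F 1 = 1 := by simp [hF, Skeleton.nu]
  have hmul : ∀ {m n : ℕ}, m.Coprime n → F (m * n) = F m * F n := by
    intro m n hmn
    simp only [hF, Skeleton.nu, divisorSumChar_mul_of_coprime χ hmn, map_mul]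
    ring
  have hsum : Summable (fun n => ‖F n‖) := by
    obtain ⟨C, hC1, hC⟩ :=
      Literature.NumberTheory.Sieve.exists_card_divisors_le_mul_rpow' (ε := (s.re - 1) / 4)
        (by linarith)
    have hmaj : Summable (fun n : ℕ => C ^ 2 * (n : ℝ) ^ (-((s.re + 1) / 2))) := by
      refine (Real.summable_nat_rpow.mpr ?_).mul_left _
      linarith
    refine hmaj.of_nonneg_of_le (fun _ => norm_nonneg _) fun n => ?_
    rcases eq_or_ne n 0 with rfl | hn
    · simp [hF0, Real.zero_rpow (by linarith : -((s.re + 1) / 2) ≠ 0)]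
    · have hn' : 0 < (n : ℝ) := by positivity
      rw [hF, norm_mul, norm_pow, hFx, Complex.norm_natCast_cpow_of_pos (Nat.pos_of_ne_zero hn),
        neg_re]
      have hd : ‖Skeleton.nu χ n‖ ≤ C * (n : ℝ) ^ ((s.re - 1) / 4) :=
        (norm_divisorSumChar_le χ n).trans (hC n)
      calc ‖Skeleton.nu χ n‖ ^ 2 * (n : ℝ) ^ (-s.re)
          ≤ (C * (n : ℝ) ^ ((s.re - 1) / 4)) ^ 2 * (n : ℝ) ^ (-s.re) := by
            gcongr
        _ = C ^ 2 * ((n : ℝ) ^ ((s.re - 1) / 4 * 2) * (n : ℝ) ^ (-s.re)) := by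
            rw [mul_pow, Real.rpow_mul hn'.le]; norm_cast; ring
        _ = C ^ 2 * (n : ℝ) ^ (-((s.re + 1) / 2)) := by
            rw [← Real.rpow_add hn']; congr 1; ring_nf
  have hE := EulerProduct.eulerProduct_hasProd hF1 hmul hsum hF0
  have hL : ∑' n, F n = L (fun n => Skeleton.nu χ n ^ 2) s := by
    simp_rw [hFterm]; rfl
  rw [hL] at hE
  -- the local factor of `hE` at `p` is the series inside `phiLocal`
  have hloc : ∀ p : Nat.Primes, ∑' e : ℕ, F ((p : ℕ) ^ e) =
      ∑' e : ℕ, Skeleton.nu χ ((p : ℕ) ^ e) ^ 2 * ((p : ℕ) : ℂ) ^ (-((e : ℂ) * s)) := by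
    intro p
    refine tsum_congr fun e => ?_
    change Skeleton.nu χ ((p : ℕ) ^ e) ^ 2 * riemannZetaSummandHom hs0 ((p : ℕ) ^ e) = _
    rw [map_pow, hFx, ← Complex.cpow_nat_mul]
    congr 2
    ring
  -- (ii) `∏_p (1 − p⁻ˢ) → ζ(s)⁻¹` and `∏_p (1 − χ(p)p⁻ˢ) → L(s,χ)⁻¹`
  have hζne : riemannZeta s ≠ 0 := riemannZeta_ne_zero_of_one_lt_re hs
  have hLne : χ.LFunction s ≠ 0 :=
    DirichletCharacter.LFunction_ne_zero_of_one_le_re χ (Or.inr hs1) hs.le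
  have T1 : Tendsto (fun S : Finset Nat.Primes => ∏ p ∈ S, (1 - ((p : ℕ) : ℂ) ^ (-s))) atTop
      (nhds (riemannZeta s)⁻¹) := by
    have h := (riemannZeta_eulerProduct_hasProd hs).inv₀ hζne
    refine h.congr fun S => ?_
    rw [Finset.prod_inv_distrib, inv_inv]
  have T2 : Tendsto (fun S : Finset Nat.Primes =>
      ∏ p ∈ S, (1 - χ ((p : ℕ) : ZMod D) * ((p : ℕ) : ℂ) ^ (-s))) atTop
      (nhds (χ.LFunction s)⁻¹) := by
    have h0 := DirichletCharacter.LSeries_eulerProduct_hasProd χ hs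
    rw [← DirichletCharacter.LFunction_eq_LSeries χ hs] at h0
    have h := h0.inv₀ hLne
    refine h.congr fun S => ?_
    rw [Finset.prod_inv_distrib, inv_inv]
  -- (iii) combine
  have T := ((T1.pow 2).mul (T2.pow 2)).mul hE
  unfold HasProd
  have hfun : (fun S : Finset Nat.Primes => ∏ p ∈ S, phiLocal χ (p : ℕ) s) =
      fun S : Finset Nat.Primes => (∏ p ∈ S, (1 - ((p : ℕ) : ℂ) ^ (-s))) ^ 2 *
        (∏ p ∈ S, (1 - χ ((p : ℕ) : ZMod D) * ((p : ℕ) : ℂ) ^ (-s))) ^ 2 *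
        ∏ p ∈ S, ∑' e : ℕ, F ((p : ℕ) ^ e) := by
    funext S
    rw [← Finset.prod_pow, ← Finset.prod_pow, ← Finset.prod_mul_distrib, ← Finset.prod_mul_distrib]
    refine Finset.prod_congr rfl fun p _ => ?_
    rw [phiLocal, hloc]
  have hlim : phiSeries χ s =
      (riemannZeta s)⁻¹ ^ 2 * (χ.LFunction s)⁻¹ ^ 2 * L (fun n => Skeleton.nu χ n ^ 2) s := by
    rw [phiSeries, inv_pow, inv_pow]
  rw [hfun, hlim]
  exact T

/-- `Step3u003` — `_holds` alias of `step3u003_holds` above under the fact's exact name (appended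
2026-08-28, D-0026 bookkeeping: the proof term is the existing theorem of this file; no statement,
definition or attribute is edited; no new named fact; the ledger's debt table listed the fact
unproved). [cite: Zhang2022LandauSiegel, §3 p.13] -/
theorem _root_.Literature.NumberTheory.LFunctions.Zhang2022.Section3.Step3u003_holds :
    Step3u003 χ :=
  _root_.Literature.NumberTheory.LFunctions.Zhang2022.Section3.step3u003_holds (χ := χ)

/-- `2 ≤ log D` for `D ≥ 9` (`e² < 9`). [folklore] -/
private theorem two_le_ell {D : ℕ} (hD : 9 ≤ D) : 2 ≤ Skeleton.ell D := by
  have hD' : (9 : ℝ) ≤ D := by exact_mod_cast hD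
  unfold Skeleton.ell
  rw [Real.le_log_iff_exp_le (by linarith)]
  have h1 := Real.exp_one_lt_d9
  have h2 : Real.exp 2 = Real.exp 1 * Real.exp 1 := by rw [← Real.exp_add]; norm_num
  nlinarith [Real.exp_pos 1]

/-- `Z22:§3.u006`, first line [Z22 p.13, tex L734] «The left side of (3.2) is
`≪ Σ_n ν(n)²n⁻¹(exp{−n/P²} − exp{−n/D⁴})`»: `Step3u006a` holds with `C = 6`, `D ≥ 9` (DISCHARGED;
(A) is not used: `e^{−n/P²} − e^{−n/D⁴} ≥ 1/6` on `D⁴ < n ≤ P²` once `4D⁴ ≤ P²`, tree `Lemma31.sum_Ioc_le`,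
`Lemma31.W_nuSq_eq`). [cite: Zhang2022LandauSiegel, §3 p.13] -/
theorem step3u006a_holds : Step3u006a := by
  refine ⟨6, 9, fun D _ χ hD hq _ _ => ?_⟩
  have hχ : χ ^ 2 = 1 := hq.sq_eq_one
  have hD' : (9 : ℝ) ≤ D := by exact_mod_cast hD
  have hDpos : (0 : ℝ) < D := by linarith
  have hℓ2 : 2 ≤ Skeleton.ell D := two_le_ell hD
  set A : ℝ := (D : ℝ) ^ 4 with hA_def
  set B : ℝ := Skeleton.bigP D ^ 2 with hB_def
  have hA : 0 < A := by positivity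
  have hB : 0 < B := by rw [hB_def]; unfold Skeleton.bigP; positivity
  -- `4D⁴ ≤ P²`: `4e^{4ℓ} ≤ e²e^{4ℓ} = e^{2+4ℓ} ≤ e^{2ℓ⁹}`
  have hAB : 4 * A ≤ B := by
    have hDexp : (D : ℝ) = Real.exp (Skeleton.ell D) := by
      unfold Skeleton.ell; rw [Real.exp_log hDpos]
    have hA' : A = Real.exp (4 * Skeleton.ell D) := by
      rw [hA_def, hDexp, ← Real.exp_nat_mul]; norm_num
    have hB' : B = Real.exp (2 * Skeleton.ell D ^ 9) := by
      rw [hB_def]; unfold Skeleton.bigP; rw [← Real.exp_nat_mul]; norm_num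
    have h4 : (4 : ℝ) ≤ Real.exp 2 := by
      have h1 := Real.exp_one_gt_d9
      have h2 : Real.exp 2 = Real.exp 1 * Real.exp 1 := by rw [← Real.exp_add]; norm_num
      nlinarith
    have hexp : 2 + 4 * Skeleton.ell D ≤ 2 * Skeleton.ell D ^ 9 := by
      have h8 : (2 : ℝ) ^ 8 ≤ Skeleton.ell D ^ 8 := pow_le_pow_left₀ (by norm_num) hℓ2 8
      nlinarith
    rw [hA', hB']
    calc 4 * Real.exp (4 * Skeleton.ell D) ≤ Real.exp 2 * Real.exp (4 * Skeleton.ell D) := by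
          gcongr
      _ = Real.exp (2 + 4 * Skeleton.ell D) := by rw [Real.exp_add]
      _ ≤ Real.exp (2 * Skeleton.ell D ^ 9) := Real.exp_le_exp.mpr hexp
  have hM : A ≤ ((D ^ 4 : ℕ) : ℝ) := by rw [hA_def]; push_cast; exact le_rfl
  have hN : ((⌊B⌋₊ : ℕ) : ℝ) ≤ B := Nat.floor_le hB.le
  have key := Lemma31.sum_Ioc_le χ hχ hA hAB hM hN
  -- the left side is the real sum `Σ |ν(n)|²/n`
  have hlhs : ∑ n ∈ Finset.Ioc (D ^ 4) ⌊B⌋₊, Skeleton.nu χ n ^ 2 / (n : ℂ) =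
      ((∑ n ∈ Finset.Ioc (D ^ 4) ⌊B⌋₊, ‖divisorSumChar χ n‖ ^ 2 / n : ℝ) : ℂ) := by
    push_cast
    refine Finset.sum_congr rfl fun n _ => ?_
    change divisorSumChar χ n ^ 2 / (n : ℂ) = _
    rw [Lemma31.divisorSumChar_sq_eq χ hχ n]
    push_cast; rfl
  have hlhs0 : 0 ≤ ∑ n ∈ Finset.Ioc (D ^ 4) ⌊B⌋₊, ‖divisorSumChar χ n‖ ^ 2 / n :=
    Finset.sum_nonneg fun n _ => by positivity
  -- the right side is `Σ' |ν(n)|²/n (e^{-n/B} − e^{-n/A})`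
  have hrhs : (W (fun n => divisorSumChar χ n ^ 2) B - W (fun n => divisorSumChar χ n ^ 2) A).re =
      ∑' n : ℕ, ‖Skeleton.nu χ n‖ ^ 2 / n *
        (Real.exp (-(n / B)) - Real.exp (-(n / A))) := by
    rw [Lemma31.W_nuSq_eq χ hχ, Lemma31.W_nuSq_eq χ hχ, ← ofReal_sub, ofReal_re,
      ← (Lemma31.summable_nuSq χ hB).tsum_sub (Lemma31.summable_nuSq χ hA)]
    refine tsum_congr fun n => ?_
    change _ = ‖divisorSumChar χ n‖ ^ 2 / n * _
    ring
  rw [hlhs, Complex.norm_real, Real.norm_eq_abs, abs_of_nonneg hlhs0, ← hrhs]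
  exact key

omit [NeZero D] in
/-- The coefficient sequence `b(n) = ν(n)²/n` of the Mellin representation has `|b(n)| ≤ C² n^{−1/2}`
(divisor bound `d(n) ≤ C n^{1/4}`). [folklore] -/
private theorem exists_norm_nu_sq_div_le :
    ∃ C : ℝ, ∀ n : ℕ, n ≠ 0 → ‖Skeleton.nu χ n ^ 2 / (n : ℂ)‖ ≤ C * (n : ℝ) ^ ((1 / 2 : ℝ) - 1) := by
  obtain ⟨C, hC1, hC⟩ :=
    Literature.NumberTheory.Sieve.exists_card_divisors_le_mul_rpow' (ε := 1 / 4) (by norm_num)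
  refine ⟨C ^ 2, fun n hn => ?_⟩
  have hn' : (0 : ℝ) < n := by exact_mod_cast Nat.pos_of_ne_zero hn
  have hν : ‖Skeleton.nu χ n‖ ≤ C * (n : ℝ) ^ (1 / 4 : ℝ) :=
    (norm_divisorSumChar_le χ n).trans (hC n)
  rw [norm_div, norm_pow, Complex.norm_natCast]
  calc ‖Skeleton.nu χ n‖ ^ 2 / n ≤ (C * (n : ℝ) ^ (1 / 4 : ℝ)) ^ 2 / n := by gcongr
    _ = C ^ 2 * ((n : ℝ) ^ (1 / 2 : ℝ) / n) := by
        rw [mul_pow, ← Real.rpow_natCast ((n : ℝ) ^ (1 / 4 : ℝ)) 2, ← Real.rpow_mul hn'.le]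
        norm_num; ring
    _ = C ^ 2 * (n : ℝ) ^ ((1 / 2 : ℝ) - 1) := by rw [Real.rpow_sub_one hn'.ne']

/-- `Z22:§3.u006`, second line [Z22 p.13, tex L737] «`= (1/2πi)∫_{(1)} φ(1+s)ζ(1+s)²L(1+s,χ)²(P^{2s} −
D^{4s})Γ(s) ds`»: `Step3u006b` holds (DISCHARGED; every `D ≥ 1`, (A) unused) — the Cahen–Mellin
representation `Σ_{n≥1} b(n)e^{−nw} = (1/2π)∫ L_b(1+iy) w^{−(1+iy)}Γ(1+iy) dy` (tree
`Literature.Analysis.Complex.tsum_mul_exp_neg_eq_integral_LSeries`, `c = 1`) for `b(n) = ν(n)²/n`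
(`|b(n)| ≪ n^{−1/2}`, so `Σ b(n)n⁻ˢ` converges absolutely on `Re s = 1`), at `w = 1/P²` and `w = 1/D⁴`,
with `L_b(1+iy) = Σν(n)²n^{−(2+iy)} = φ(2+iy)ζ(2+iy)²L(2+iy,χ)²` (`phiSeries_eq_phi`) and
`P^{2(1+iy)} = (1/P²)^{−(1+iy)}`; both integrands are integrable (`|L_b| ≤ Σ|b(n)|/n`, `Γ(1+iy) ∈ L¹`).
[cite: Zhang2022LandauSiegel, §3 p.13] -/
theorem step3u006b_holds : Step3u006b := by
  refine ⟨1, fun D _ χ _ hq _ _ => ?_⟩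
  have hχ : χ ^ 2 = 1 := hq.sq_eq_one
  have hDpos : (0 : ℝ) < D := by exact_mod_cast Nat.pos_of_ne_zero (NeZero.ne D)
  have hbigP : 0 < Skeleton.bigP D := by unfold Skeleton.bigP; exact Real.exp_pos _
  set P2 : ℝ := Skeleton.bigP D ^ 2 with hP2_def
  set D4 : ℝ := (D : ℝ) ^ 4 with hD4_def
  have hP2 : 0 < P2 := by positivity
  have hD4 : 0 < D4 := by positivity
  set b : ℕ → ℂ := fun n => Skeleton.nu χ n ^ 2 / (n : ℂ) with hb
  -- (i) summability of `Σ b(n) n⁻ˢ` on `re s = 1` and continuity there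
  obtain ⟨C, hC⟩ := exists_norm_nu_sq_div_le χ
  have hsum1 : LSeriesSummable b 1 :=
    LSeriesSummable_of_le_const_mul_rpow (x := 1 / 2) (by norm_num) ⟨C, hC⟩
  have habs : LSeries.abscissaOfAbsConv b ≤ (-(1 / 2) : ℝ) + 1 :=
    LSeries.abscissaOfAbsConv_le_of_le_const_mul_rpow ⟨C, fun n hn => by
      have := hC n hn; rw [hb]; norm_num at this ⊢; exact this⟩
  have hLcont : Continuous fun y : ℝ => L b (1 + y * I) := by
    have hline : Continuous fun y : ℝ => (1 : ℂ) + y * I := by fun_prop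
    refine (LSeries_differentiableOn b).continuousOn.comp_continuous hline fun y => ?_
    show LSeries.abscissaOfAbsConv b < (((1 : ℂ) + y * I).re : EReal)
    refine lt_of_le_of_lt habs ?_
    simp only [add_re, one_re, mul_re, ofReal_re, I_re, mul_zero, ofReal_im, I_im, mul_one,
      sub_self, add_zero]
    exact_mod_cast (by norm_num : (-(1 / 2) : ℝ) + 1 < 1)
  have hBsum : Summable fun n => ‖LSeries.term b 1 n‖ := summable_norm_iff.mpr hsum1
  set B : ℝ := ∑' n, ‖LSeries.term b 1 n‖ with hB_def
  have hLbound : ∀ y : ℝ, ‖L b (1 + y * I)‖ ≤ B := by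
    intro y
    refine tsum_of_norm_bounded hBsum.hasSum fun n => ?_
    rw [LSeries.norm_term_eq, LSeries.norm_term_eq]
    simp
  -- (ii) the Cahen–Mellin integrand on `re s = 1` and its integrability
  have hInt : ∀ {Y : ℝ}, 0 < Y → Integrable (fun y : ℝ => L b (1 + y * I) *
      ((((1 / Y : ℝ) : ℂ) ^ (-(1 + y * I))) * Complex.Gamma (1 + y * I))) := by
    intro Y hY
    have hY' : (0 : ℝ) < 1 / Y := by positivity
    have hΓ : Integrable fun y : ℝ => Complex.Gamma (1 + y * I) := by
      simpa using Literature.Analysis.SpecialFunctions.integrable_Gamma_vertical one_pos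
        (by norm_num : (1 : ℝ) ≤ 2)
    have hcont : Continuous fun y : ℝ => L b (1 + y * I) *
        ((((1 / Y : ℝ) : ℂ) ^ (-(1 + y * I))) * Complex.Gamma (1 + y * I)) := by
      refine hLcont.mul (Continuous.mul ?_ ?_)
      · exact Continuous.const_cpow (by fun_prop) (Or.inl (Complex.ofReal_ne_zero.mpr hY'.ne'))
      · simpa using ZetaM4.continuous_Gamma_line_pos one_pos
    refine ((hΓ.norm.const_mul (B * (1 / Y) ^ (-(1 : ℝ)))).mono' hcont.aestronglyMeasurable
      (Eventually.of_forall fun y => ?_))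
    rw [norm_mul, norm_mul, Complex.norm_cpow_eq_rpow_re_of_pos hY']
    have hre : (-(1 + (y : ℂ) * I)).re = -(1 : ℝ) := by simp
    rw [hre]
    have h0 : 0 ≤ (1 / Y) ^ (-(1 : ℝ)) * ‖Complex.Gamma (1 + y * I)‖ := by positivity
    calc ‖L b (1 + y * I)‖ * ((1 / Y) ^ (-(1 : ℝ)) * ‖Complex.Gamma (1 + y * I)‖)
        ≤ B * ((1 / Y) ^ (-(1 : ℝ)) * ‖Complex.Gamma (1 + y * I)‖) :=
          mul_le_mul_of_nonneg_right (hLbound y) h0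
      _ = B * (1 / Y) ^ (-(1 : ℝ)) * ‖Complex.Gamma (1 + y * I)‖ := by ring
  -- (iii) Cahen–Mellin: `Σ |ν(n)|² e^{-n/Y}/n = (1/2π) ∫ L_b(1+iy) (1/Y)^{-(1+iy)} Γ(1+iy) dy`
  have hCM : ∀ {Y : ℝ}, 0 < Y →
      ((∑' n : ℕ, ‖divisorSumChar χ n‖ ^ 2 * Real.exp (-(n / Y)) / n : ℝ) : ℂ) =
        (1 / (2 * π) : ℂ) * ∫ y : ℝ, L b (1 + y * I) *
          ((((1 / Y : ℝ) : ℂ) ^ (-(1 + y * I))) * Complex.Gamma (1 + y * I)) := by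
    intro Y hY
    have T := Literature.Analysis.Complex.tsum_mul_exp_neg_eq_integral_LSeries b one_pos
      (by norm_num : (1 : ℝ) ≤ 2) hsum1 (w := 1 / Y) (by positivity)
    simp only [Complex.ofReal_one] at T
    rw [← T, Complex.ofReal_tsum]
    refine tsum_congr fun n => ?_
    rcases eq_or_ne n 0 with rfl | hn
    · simp
    · simp only [hn, if_false, hb]
      have hsq : Skeleton.nu χ n ^ 2 = ((‖divisorSumChar χ n‖ ^ 2 : ℝ) : ℂ) :=
        Lemma31.divisorSumChar_sq_eq χ hχ n
      rw [hsq]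
      have : -((n : ℝ) * (1 / Y)) = -(n / Y) := by ring
      rw [this]
      push_cast
      ring
  -- (iv) the integrand of `Step3u006b` on `re s = 1` splits into the two Cahen–Mellin integrands
  have hpt : ∀ y : ℝ, integrand31 χ (1 + y * I) =
      L b (1 + y * I) * ((((1 / P2 : ℝ) : ℂ) ^ (-(1 + y * I))) * Complex.Gamma (1 + y * I)) -
      L b (1 + y * I) * ((((1 / D4 : ℝ) : ℂ) ^ (-(1 + y * I))) * Complex.Gamma (1 + y * I)) := by
    intro y
    set s' : ℂ := 1 + y * I with hs'
    have h1 : 1 < (1 + s').re := by simp [hs']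
    have hLb : L b s' = L (fun n => Skeleton.nu χ n ^ 2) (1 + s') := by
      refine tsum_congr fun n => ?_
      rcases eq_or_ne n 0 with rfl | hn
      · simp [LSeries.term]
      · have hn0 : (n : ℂ) ≠ 0 := Nat.cast_ne_zero.mpr hn
        rw [LSeries.term_of_ne_zero hn, LSeries.term_of_ne_zero hn, hb]
        simp only
        rw [show (n : ℂ) ^ (1 + s') = n * (n : ℂ) ^ s' by rw [cpow_add _ _ hn0, cpow_one],
          div_div]
    have hs1 : 1 + s' ≠ 1 := by
      intro h; rw [h] at h1; simp at h1
    have hζ : riemannZeta (1 + s') ≠ 0 := riemannZeta_ne_zero_of_one_lt_re h1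
    have hL : χ.LFunction (1 + s') ≠ 0 :=
      DirichletCharacter.LFunction_ne_zero_of_one_le_re χ (Or.inr hs1) h1.le
    have hLν : L (fun n => Skeleton.nu χ n ^ 2) (1 + s') =
        DivisorSumCharSq.phi D (1 + s') * riemannZeta (1 + s') ^ 2 * χ.LFunction (1 + s') ^ 2 := by
      rw [← phiSeries_eq_phi χ hχ h1, phiSeries]
      field_simp
    have hP : (((Skeleton.bigP D : ℝ)) : ℂ) ^ (2 * s') = (((1 / P2 : ℝ)) : ℂ) ^ (-s') := by
      rw [ofReal_cpow_eq_exp_log hbigP, ofReal_cpow_eq_exp_log (by positivity)]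
      congr 1
      rw [hP2_def, one_div, Real.log_inv, Real.log_pow]
      push_cast
      ring
    have hDD : (((D : ℝ)) : ℂ) ^ (4 * s') = (((1 / D4 : ℝ)) : ℂ) ^ (-s') := by
      rw [ofReal_cpow_eq_exp_log hDpos, ofReal_cpow_eq_exp_log (by positivity)]
      congr 1
      rw [hD4_def, one_div, Real.log_inv, Real.log_pow]
      push_cast
      ring
    have hhead : DivisorSumCharSq.phi D (1 + s') * riemannZeta (1 + s') ^ 2 *
        χ.LFunction (1 + s') ^ 2 = L b s' := by rw [hLb, hLν]
    unfold integrand31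
    rw [hhead, hP, hDD]
    ring
  -- (v) assemble
  have hsplit : (∑' n : ℕ, ‖Skeleton.nu χ n‖ ^ 2 / n *
      (Real.exp (-(n / P2)) - Real.exp (-(n / D4)))) =
      (∑' n : ℕ, ‖divisorSumChar χ n‖ ^ 2 * Real.exp (-(n / P2)) / n) -
        ∑' n : ℕ, ‖divisorSumChar χ n‖ ^ 2 * Real.exp (-(n / D4)) / n := by
    rw [← (Lemma31.summable_nuSq χ hP2).tsum_sub (Lemma31.summable_nuSq χ hD4)]
    refine tsum_congr fun n => ?_
    change ‖divisorSumChar χ n‖ ^ 2 / n * _ = _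
    ring
  rw [hsplit, Complex.ofReal_sub, hCM hP2, hCM hD4, ← mul_sub, ← integral_sub (hInt hP2) (hInt hD4)]
  congr 1
  refine integral_congr_ae (Eventually.of_forall fun y => ?_)
  exact (hpt y).symm

end EulerMellin

/-! ## Wave-2e: the circle-integral estimate of the Lemma 3.2 sketch (`u013`) -/

section CircleIntegral

variable {D : ℕ} [NeZero D] (χ : DirichletCharacter ℂ D)

/-- **The elementary factors of `Z22:§3.u013` on `|s| = α* = 𝓛⁻²⁰²⁴`**: eventually in `D`, for
`‖s‖ = 𝓛⁻²⁰²⁴`, `‖ζ(1+s)‖ ≤ 2𝓛²⁰²⁴` and `‖(D^{8s} − D^{4s})Γ(s)‖ ≤ 144𝓛`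
(`D^{8s} − D^{4s} = e^{8s𝓛} − e^{4s𝓛}` has norm `≤ 6|s|·12𝓛`, `Γ(s) = Γ(s+1)/s`, `‖Γ(s+1)‖ ≤ 2`).
[cite: Zhang2022LandauSiegel, §3 p.14] -/
theorem step3u013_core :
    ∃ D₀ : ℕ, ∀ D : ℕ, D₀ ≤ D → ∀ s : ℂ, ‖s‖ = (Skeleton.ell D ^ 2024)⁻¹ →
      ‖riemannZeta (1 + s)‖ ≤ 2 * Skeleton.ell D ^ 2024 ∧
      ‖(((D : ℝ) : ℂ) ^ (8 * s) - ((D : ℝ) : ℂ) ^ (4 * s)) * Complex.Gamma s‖ ≤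
        144 * Skeleton.ell D := by
  obtain ⟨δ₁, hδ₁, hζ⟩ := norm_zeta_one_add_le_near_zero
  obtain ⟨δ₂, hδ₂, hΓ⟩ := norm_Gamma_le_two_near_one
  set M : ℝ := max 2 (max (1 / δ₁ + 1) (1 / δ₂ + 1)) with hM
  refine ⟨⌈Real.exp M⌉₊, fun D hD s hs => ?_⟩
  have hℓM : M ≤ Skeleton.ell D := by
    have h : Real.exp M ≤ D := le_trans (Nat.le_ceil _) (by exact_mod_cast hD)
    exact (Real.le_log_iff_exp_le (lt_of_lt_of_le (Real.exp_pos _) h)).mpr h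
  set ℓ : ℝ := Skeleton.ell D with hℓdef
  have hℓ2 : 2 ≤ ℓ := le_trans (le_max_left _ _) hℓM
  have hℓ1 : 1 ≤ ℓ := by linarith
  have hℓ0 : 0 < ℓ := by linarith
  have hD0 : (0 : ℝ) < D := by
    have : Real.exp M ≤ D := le_trans (Nat.le_ceil _) (by exact_mod_cast hD)
    exact lt_of_lt_of_le (Real.exp_pos _) this
  have hpow : ℓ ≤ ℓ ^ 2024 := le_self_pow₀ hℓ1 (by norm_num)
  have hsle : ‖s‖ ≤ ℓ⁻¹ := by rw [hs]; exact inv_anti₀ hℓ0 hpow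
  have hs0 : s ≠ 0 := by
    rw [← norm_pos_iff, hs]; positivity
  have hsδ₁ : ‖s‖ < δ₁ := by
    have h1 : 1 / δ₁ + 1 ≤ ℓ := le_trans (le_trans (le_max_left _ _) (le_max_right _ _)) hℓM
    have h2 : ℓ⁻¹ < δ₁ := by
      rw [inv_lt_comm₀ hℓ0 hδ₁, ← one_div]; linarith
    exact lt_of_le_of_lt hsle h2
  have hsδ₂ : ‖s‖ < δ₂ := by
    have h1 : 1 / δ₂ + 1 ≤ ℓ := le_trans (le_trans (le_max_right _ _) (le_max_right _ _)) hℓM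
    have h2 : ℓ⁻¹ < δ₂ := by
      rw [inv_lt_comm₀ hℓ0 hδ₂, ← one_div]; linarith
    exact lt_of_le_of_lt hsle h2
  refine ⟨?_, ?_⟩
  · calc ‖riemannZeta (1 + s)‖ ≤ 2 / ‖s‖ := hζ s hs0 hsδ₁
      _ = 2 * ℓ ^ 2024 := by rw [hs, div_inv_eq_mul]
  · have h8 : ((D : ℝ) : ℂ) ^ (8 * s) = Complex.exp (8 * s * (ℓ : ℂ)) := by
      rw [ofReal_cpow_eq_exp_log hD0, hℓdef, Skeleton.ell]
    have h4 : ((D : ℝ) : ℂ) ^ (4 * s) = Complex.exp (4 * s * (ℓ : ℂ)) := by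
      rw [ofReal_cpow_eq_exp_log hD0, hℓdef, Skeleton.ell]
    set a : ℂ := 8 * s * (ℓ : ℂ) with ha
    set b : ℂ := 4 * s * (ℓ : ℂ) with hb
    have hna : ‖a‖ = 8 * ‖s‖ * ℓ := by
      rw [ha, norm_mul, norm_mul, Complex.norm_real, Real.norm_of_nonneg hℓ0.le]
      norm_num
    have hnb : ‖b‖ = 4 * ‖s‖ * ℓ := by
      rw [hb, norm_mul, norm_mul, Complex.norm_real, Real.norm_of_nonneg hℓ0.le]
      norm_num
    have h16 : (16 : ℝ) ≤ ℓ ^ 2023 :=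
      calc (16 : ℝ) = 2 ^ 4 := by norm_num
        _ ≤ 2 ^ 2023 := pow_le_pow_right₀ (by norm_num) (by norm_num)
        _ ≤ ℓ ^ 2023 := pow_le_pow_left₀ (by norm_num) hℓ2 2023
    have hsl : ‖s‖ * ℓ = (ℓ ^ 2023)⁻¹ := by
      rw [hs]
      have : ℓ ^ 2024 = ℓ * ℓ ^ 2023 := by rw [← pow_succ']
      rw [this]; field_simp
    have hinv : (ℓ ^ 2023)⁻¹ ≤ 16⁻¹ := inv_anti₀ (by norm_num) h16
    have ha' : ‖a‖ ≤ 1 / 2 := by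
      rw [hna, mul_assoc, hsl]; linarith
    have hb' : ‖b‖ ≤ 1 / 2 := by
      rw [hnb, mul_assoc, hsl]; linarith
    have hdiff : ‖Complex.exp a - Complex.exp b‖ ≤ 6 * (12 * ℓ * ‖s‖) := by
      refine (norm_exp_sub_exp_le_of_half ha' hb').trans (le_of_eq ?_)
      rw [hna, hnb]; ring
    have hΓs : Complex.Gamma s = Complex.Gamma (s + 1) / s := by
      rw [Complex.Gamma_add_one s hs0, mul_div_cancel_left₀ _ hs0]
    have hΓ1 : ‖Complex.Gamma (s + 1)‖ ≤ 2 := hΓ (s + 1) (by rw [add_sub_cancel_right]; exact hsδ₂)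
    have hsnorm : 0 < ‖s‖ := norm_pos_iff.mpr hs0
    rw [h8, h4, hΓs, norm_mul, norm_div]
    calc ‖Complex.exp a - Complex.exp b‖ * (‖Complex.Gamma (s + 1)‖ / ‖s‖)
        ≤ 6 * (12 * ℓ * ‖s‖) * (2 / ‖s‖) := by gcongr
      _ = 144 * ℓ := by field_simp; norm_num

/-- `Z22:§3.u013` [Z22 p.14, tex L773] «one can verify that
`∫_{|s|=α*} φ*(1+s)ζ(1+s)⁸L(1+s,χ)⁸(D^{8s} − D^{4s})Γ(s) ds ≪ 𝓛⁻²⁰⁰⁷`» (under (A)): `Step3u013` holds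
(DISCHARGED) with `C = 2π·K·2⁸|C_L|⁸·144`, `K = exp(7659·Σ_p p^{−3/2})`: on `|s| = α* = 𝓛⁻²⁰²⁴`,
`‖φ*(1+s)‖ ≤ K` (tree `PhiStar.norm_phiStar_le_of_re_cpow_nonneg` — `Re(1+s) ≥ 3/4` and
`Re p^{−(1+s)} ≥ 0` for `p ∣ D` since `|Im s|·log p ≤ 𝓛⁻²⁰²³ ≤ π/2`, `PhiFlat.re_natCast_cpow_neg_nonneg`),
`‖ζ(1+s)‖ ≤ 2𝓛²⁰²⁴`, `‖L(1+s,χ)‖ ≤ C_L𝓛⁻²⁰²²` ((A), `step3u008_holds`), `‖(D^{8s} − D^{4s})Γ(s)‖ ≤ 144𝓛`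
(`step3u013_core`); so the integrand is `≤ K2⁸|C_L|⁸144·𝓛¹⁷` and the circle has length `2π𝓛⁻²⁰²⁴`:
`17 − 2024 = −2007`. [cite: Zhang2022LandauSiegel, §3 p.14] -/
theorem step3u013_holds : Step3u013 := by
  obtain ⟨CL, D₁, hL⟩ := step3u008_holds
  obtain ⟨D₂, hcore⟩ := step3u013_core
  set K : ℝ := Real.exp (7659 * ∑' p : Nat.Primes, ((p : ℕ) : ℝ) ^ (-(2 * (3 / 4 : ℝ)))) with hK
  refine ⟨2 * π * (K * (2 ^ 8 * |CL| ^ 8 * 144)), max D₁ (max D₂ 9),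
    fun D _ χ hD hq hprim hA => ?_⟩
  have hD₁ : D₁ ≤ D := le_trans (le_max_left _ _) hD
  have hD₂ : D₂ ≤ D := le_trans (le_trans (le_max_left _ _) (le_max_right _ _)) hD
  have hD9 : 9 ≤ D := le_trans (le_trans (le_max_right _ _) (le_max_right _ _)) hD
  have hχ : χ ^ 2 = 1 := hq.sq_eq_one
  set ℓ : ℝ := Skeleton.ell D with hℓdef
  have hℓ2 : 2 ≤ ℓ := two_le_ell hD9
  have hℓ0 : 0 < ℓ := by linarith
  have hα : alphaStar D = (ℓ ^ 2024)⁻¹ := rfl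
  have hDpos : (0 : ℝ) < D := by exact_mod_cast Nat.pos_of_ne_zero (NeZero.ne D)
  -- `α* ≤ 1/4` and `α*·ℓ ≤ 1`
  have h4 : (4 : ℝ) ≤ ℓ ^ 2024 :=
    calc (4 : ℝ) = 2 ^ 2 := by norm_num
      _ ≤ 2 ^ 2024 := pow_le_pow_right₀ (by norm_num) (by norm_num)
      _ ≤ ℓ ^ 2024 := pow_le_pow_left₀ (by norm_num) hℓ2 2024
  have hα4 : (ℓ ^ 2024)⁻¹ ≤ 1 / 4 := by rw [one_div]; exact inv_anti₀ (by norm_num) h4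
  have hαℓ : (ℓ ^ 2024)⁻¹ * ℓ ≤ 1 := by
    have h1 : ℓ ≤ ℓ ^ 2024 := le_self_pow₀ (by linarith) (by norm_num)
    rw [inv_mul_le_iff₀ (by positivity)]; linarith
  -- pointwise bound on the circle
  have hpt : ∀ z ∈ Metric.sphere (0 : ℂ) (alphaStar D),
      ‖integrand32 χ z‖ ≤ K * (2 ^ 8 * |CL| ^ 8 * 144) * ℓ ^ 17 := by
    intro z hz
    have hzn : ‖z‖ = (ℓ ^ 2024)⁻¹ := by simpa [hα] using hz
    obtain ⟨hζ, hΓ⟩ := hcore D hD₂ z hzn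
    have hLz : ‖χ.LFunction (1 + z)‖ ≤ |CL| * (ℓ ^ 2022)⁻¹ :=
      (hL D χ hD₁ hq hprim hA z hzn).trans
        (mul_le_mul_of_nonneg_right (le_abs_self CL) (by positivity))
    -- `φ*(1+z)` is absolutely bounded: `re(1+z) ≥ 3/4`, `re p^{-(1+z)} ≥ 0` for `p ∣ D`
    have hre34 : (3 / 4 : ℝ) ≤ (1 + z).re := by
      have h := Complex.abs_re_le_norm z
      rw [hzn] at h
      have := neg_le_of_abs_le h
      simp only [add_re, one_re]
      linarith
    have hre : ∀ p : ℕ, p.Prime → p ∣ D → 0 ≤ (((p : ℕ) : ℂ) ^ (-(1 + z))).re := by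
      intro p hp hpD
      refine PhiFlat.re_natCast_cpow_neg_nonneg hp.pos ?_
      have him : |(1 + z).im| ≤ (ℓ ^ 2024)⁻¹ := by
        simp only [add_im, one_im, zero_add]
        exact (Complex.abs_im_le_norm z).trans hzn.le
      have hlogp : Real.log p ≤ ℓ := by
        rw [hℓdef]; unfold Skeleton.ell
        exact Real.log_le_log (by exact_mod_cast hp.pos)
          (by exact_mod_cast Nat.le_of_dvd (Nat.pos_of_ne_zero (NeZero.ne D)) hpD)
      have hlogp0 : 0 ≤ Real.log p := Real.log_natCast_nonneg p
      calc |(1 + z).im| * Real.log p ≤ (ℓ ^ 2024)⁻¹ * ℓ :=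
            mul_le_mul him hlogp hlogp0 (by positivity)
        _ ≤ 1 := hαℓ
        _ ≤ π / 2 := by linarith [Real.pi_gt_three]
    have hφ : ‖PhiStar.phiStar χ (1 + z)‖ ≤ K :=
      PhiStar.norm_phiStar_le_of_re_cpow_nonneg χ hχ (by norm_num) hre34 hre
    -- assemble
    have hsplit : integrand32 χ z =
        (PhiStar.phiStar χ (1 + z) * riemannZeta (1 + z) ^ 8 * χ.LFunction (1 + z) ^ 8) *
          ((((D : ℝ) : ℂ) ^ (8 * z) - ((D : ℝ) : ℂ) ^ (4 * z)) * Complex.Gamma z) := by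
      unfold integrand32; ring
    have hK0 : 0 ≤ K := (Real.exp_pos _).le
    rw [hsplit, norm_mul, norm_mul, norm_mul, norm_pow, norm_pow]
    calc ‖PhiStar.phiStar χ (1 + z)‖ * ‖riemannZeta (1 + z)‖ ^ 8 * ‖χ.LFunction (1 + z)‖ ^ 8 *
          ‖(((D : ℝ) : ℂ) ^ (8 * z) - ((D : ℝ) : ℂ) ^ (4 * z)) * Complex.Gamma z‖
        ≤ K * (2 * ℓ ^ 2024) ^ 8 * (|CL| * (ℓ ^ 2022)⁻¹) ^ 8 * (144 * ℓ) := by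
          gcongr
      _ = K * (2 ^ 8 * |CL| ^ 8 * 144) * ℓ ^ 17 := by
          field_simp
  have hα0 : 0 ≤ alphaStar D := by rw [hα]; positivity
  have hint := circleIntegral.norm_integral_le_of_norm_le_const hα0 hpt
  refine hint.trans (le_of_eq ?_)
  rw [hα]
  field_simp

end CircleIntegral

/-! ## Wave-2f: the contour shift of `Z22:§3.u007` (line `re s = 1` → residue circle, error `O(D^{-1/4})`) -/

section ContourShiftGeneric

open MeasureTheory Filter Topology Set Metric
open Literature.NumberTheory.LFunctions.ZetaM4 (integrable_pow_mul_exp exists_pow_mul_exp_le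
  integral_pow_mul_exp_le)
open Literature.NumberTheory.LFunctions.HuxleyZeroDetection (integral_vertical_sub_eq_of_pole)

/-! ### Generic pieces: `∫ dy/(c+iy)² = 0`, the strip shift and the circle formula for a double pole -/

/-- The line element `y ↦ (c + iy)⁻²` is integrable for `c ≠ 0`. [folklore] -/
private theorem integrable_inv_sq_line {c : ℝ} (hc : c ≠ 0) :
    Integrable fun y : ℝ => (((c : ℂ) + y * I) ^ 2)⁻¹ := by
  have hcont : Continuous fun y : ℝ => (((c : ℂ) + y * I) ^ 2)⁻¹ := by
    refine Continuous.inv₀ (by fun_prop) fun y h => ?_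
    have h' : (c : ℂ) + y * I = 0 := pow_eq_zero_iff (n := 2) (by norm_num) |>.mp h
    have := congrArg Complex.re h'
    simp at this
    exact hc this
  have hc2 : 0 < c ^ 2 := by positivity
  refine ((integrable_inv_one_add_sq.comp_div (by exact_mod_cast hc : (c : ℝ) ≠ 0)).const_mul
    (c ^ 2)⁻¹).mono' hcont.aestronglyMeasurable (Eventually.of_forall fun y => ?_)
  rw [norm_inv, norm_pow]
  have hnorm : ‖(c : ℂ) + y * I‖ ^ 2 = c ^ 2 + y ^ 2 := by
    rw [Complex.sq_norm, Complex.normSq_apply]; simp; ring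
  rw [hnorm]
  have heq : (c ^ 2)⁻¹ * (1 + (y / c) ^ 2)⁻¹ = (c ^ 2 + y ^ 2)⁻¹ := by
    field_simp
  rw [heq]

/-- `∫_ℝ dy/(c+iy)² = 0` for real `c ≠ 0` (the antiderivative `i(c+iy)⁻¹` vanishes at `±∞`).
[folklore] -/
private theorem integral_inv_sq_line {c : ℝ} (hc : c ≠ 0) :
    ∫ y : ℝ, (((c : ℂ) + y * I) ^ 2)⁻¹ = 0 := by
  have hne : ∀ y : ℝ, (c : ℂ) + y * I ≠ 0 := fun y h => by
    have := congrArg Complex.re h; simp at this; exact hc this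
  -- antiderivative `F(y) = I · (c + iy)⁻¹`
  have hderiv : ∀ y : ℝ, HasDerivAt (fun y : ℝ => I * ((c : ℂ) + y * I)⁻¹)
      ((((c : ℂ) + y * I) ^ 2)⁻¹) y := by
    intro y
    have h1 : HasDerivAt (fun y : ℝ => (c : ℂ) + y * I) I y := by
      simpa using ((Complex.ofRealCLM.hasDerivAt (x := y)).mul_const I).const_add (c : ℂ)
    have h2 := (h1.inv (hne y)).const_mul I
    refine h2.congr_deriv ?_
    rw [← mul_div_assoc, mul_neg, Complex.I_mul_I, neg_neg, one_div]
  have hlim : ∀ l : Filter ℝ, Tendsto (fun y : ℝ => |y|) l atTop →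
      Tendsto (fun y : ℝ => I * ((c : ℂ) + y * I)⁻¹) l (nhds 0) := by
    intro l hl
    rw [tendsto_zero_iff_norm_tendsto_zero]
    have hlim' : Tendsto (fun y : ℝ => |y|⁻¹) l (nhds 0) := tendsto_inv_atTop_zero.comp hl
    refine squeeze_zero' (Eventually.of_forall fun y => norm_nonneg _) ?_ hlim'
    filter_upwards [hl.eventually (eventually_gt_atTop (0 : ℝ))] with y hy
    rw [norm_mul, Complex.norm_I, one_mul, norm_inv]
    exact inv_anti₀ hy (by simpa using Complex.abs_im_le_norm ((c : ℂ) + y * I))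
  have htop := hlim atTop (tendsto_abs_atTop_atTop)
  have hbot := hlim atBot (tendsto_abs_atBot_atTop)
  have := integral_of_hasDerivAt_of_tendsto hderiv (integrable_inv_sq_line hc) hbot htop
  simpa using this

/-- The open vertical strip `a < re z < b` is a neighbourhood of each of its points inside the
closed strip `Icc a b ×ℂ univ`. [folklore] -/
private theorem reProdIm_Icc_mem_nhds {a b : ℝ} {w : ℂ} (ha : a < w.re) (hb : w.re < b) :
    (Icc a b ×ℂ univ) ∈ nhds w := by
  refine mem_nhds_iff.mpr ⟨Ioo a b ×ℂ univ, fun z hz => ⟨Ioo_subset_Icc_self hz.1, hz.2⟩,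
    (isOpen_Ioo.reProdIm isOpen_univ), ⟨⟨ha, hb⟩, mem_univ _⟩⟩

/-- **Strip shift across a double pole.** If `h` is holomorphic on the closed strip `a ≤ re z ≤ b`
(`a < 0 < b`, `|a|, |b| ≥ 1/4`) with a bound `‖h(z)‖ ≤ K(1+|im z|)^N e^{−π|im z|/2}` there (for
`‖z‖ ≥ 1/4`), then `∫ h(b+iy)/(b+iy)² dy − ∫ h(a+iy)/(a+iy)² dy = 2π·h′(0)` (apply the tree's strip
residue theorem `HuxleyZeroDetection.integral_vertical_sub_eq_of_pole` to `dslope h 0`, and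
`∫ dy/(c+iy)² = 0`). [folklore] -/
private theorem integral_vertical_sub_eq_of_double_pole (h : ℂ → ℂ) {a b : ℝ} (ha : a < 0) (hb : 0 < b)
    (ha4 : 1 / 4 ≤ |a|) (hb4 : 1 / 4 ≤ |b|)
    (hhd : DifferentiableOn ℂ h (Icc a b ×ℂ univ)) {K : ℝ} {N : ℕ} (hK : 0 ≤ K)
    (hbound : ∀ z : ℂ, a ≤ z.re → z.re ≤ b → 1 / 4 ≤ ‖z‖ →
      ‖h z‖ ≤ K * ((1 + |z.im|) ^ N * Real.exp (-(π * |z.im| / 2)))) :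
    (∫ t : ℝ, h (b + t * I) / ((b : ℂ) + t * I) ^ 2) -
      (∫ t : ℝ, h (a + t * I) / ((a : ℂ) + t * I) ^ 2) = 2 * π * deriv h 0 := by
  set h₁ : ℂ → ℂ := dslope h 0 with hh₁
  have h0mem : (Icc a b ×ℂ univ) ∈ nhds (0 : ℂ) := reProdIm_Icc_mem_nhds (by simpa using ha) (by simpa using hb)
  have hd₁ : DifferentiableOn ℂ h₁ (Icc a b ×ℂ univ) :=
    (Complex.differentiableOn_dslope h0mem).mpr hhd
  -- `h₁(z)/z = h(z)/z² − h(0)/z²` off `0`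
  have hsplit : ∀ z : ℂ, z ≠ 0 → h₁ z / z = h z / z ^ 2 - h 0 / z ^ 2 := by
    intro z hz
    rw [hh₁, dslope_of_ne _ hz, slope_def_field, sub_zero]
    field_simp
  -- norm bound for `h₁(z)/z` on the strip, `|im z| ≥ 1` or on the lines
  have hline_ne : ∀ {c : ℝ}, c ≠ 0 → ∀ t : ℝ, (c : ℂ) + t * I ≠ 0 := fun hc t h => by
    have := congrArg Complex.re h; simp at this; exact hc this
  have hcont₁ : ∀ {c : ℝ}, a ≤ c → c ≤ b → c ≠ 0 →
      Continuous fun t : ℝ => h₁ (c + t * I) / ((c : ℂ) + t * I) := by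
    intro c hca hcb hc0
    have hline : Continuous fun t : ℝ => (c : ℂ) + t * I := by fun_prop
    refine (hd₁.continuousOn.comp_continuous hline fun t => ⟨by simpa using ⟨hca, hcb⟩, mem_univ _⟩).div
      hline fun t => hline_ne hc0 t
  have hint₁ : ∀ {c : ℝ}, a ≤ c → c ≤ b → 1 / 4 ≤ |c| →
      Integrable fun t : ℝ => h₁ (c + t * I) / ((c : ℂ) + t * I) := by
    intro c hca hcb hc4
    have hc0 : c ≠ 0 := by intro h; rw [h] at hc4; norm_num at hc4
    -- dominate by `16 K (1+|t|)^N e^{-π|t|/2} + ‖h 0‖ · |(c+it)²|⁻¹`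
    have hdom : Integrable fun t : ℝ => 16 * K * ((1 + |t|) ^ N * Real.exp (-(π * |t| / 2))) +
        ‖h 0‖ * ‖(((c : ℂ) + t * I) ^ 2)⁻¹‖ :=
      (((integrable_pow_mul_exp N).const_mul (16 * K)).add
        ((integrable_inv_sq_line hc0).norm.const_mul ‖h 0‖))
    refine hdom.mono' (hcont₁ hca hcb hc0).aestronglyMeasurable (Eventually.of_forall fun t => ?_)
    set z : ℂ := (c : ℂ) + t * I with hz
    have hz0 : z ≠ 0 := hline_ne hc0 t
    have hzre : z.re = c := by simp [hz]
    have hzim : z.im = t := by simp [hz]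
    have hzn : 1 / 4 ≤ ‖z‖ := by
      have := Complex.abs_re_le_norm z; rw [hzre] at this; exact hc4.trans this
    have hzpos : 0 < ‖z‖ := by linarith
    rw [hsplit z hz0, norm_inv, norm_pow]
    have hb1 := hbound z (by rw [hzre]; exact hca) (by rw [hzre]; exact hcb) hzn
    rw [hzim] at hb1
    have hsq : (1 / 4) ^ 2 ≤ ‖z‖ ^ 2 := pow_le_pow_left₀ (by norm_num) hzn 2
    calc ‖h z / z ^ 2 - h 0 / z ^ 2‖ ≤ ‖h z / z ^ 2‖ + ‖h 0 / z ^ 2‖ := norm_sub_le _ _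
      _ = ‖h z‖ / ‖z‖ ^ 2 + ‖h 0‖ * (‖z‖ ^ 2)⁻¹ := by
          rw [norm_div, norm_div, norm_pow, div_eq_mul_inv (‖h 0‖)]
      _ ≤ K * ((1 + |t|) ^ N * Real.exp (-(π * |t| / 2))) / (1 / 4) ^ 2 +
            ‖h 0‖ * (‖z‖ ^ 2)⁻¹ := by gcongr
      _ = 16 * K * ((1 + |t|) ^ N * Real.exp (-(π * |t| / 2))) + ‖h 0‖ * (‖z‖ ^ 2)⁻¹ := by ring
  -- horizontal decay of `h₁(z)/z`
  have hdecay : ∀ ε : ℝ, 0 < ε → ∃ T₀ : ℝ, ∀ σ ∈ Icc a b, ∀ T : ℝ, T₀ ≤ |T| →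
      ‖h₁ (σ + T * I) / (σ + T * I - 0)‖ ≤ ε := by
    intro ε hε
    obtain ⟨T₁, hT₁⟩ := exists_pow_mul_exp_le N hK one_pos
    -- for `|T| ≥ max T₁ 1`: `‖h(z)‖ ≤ 1`, so `‖h₁(z)/z‖ ≤ (1 + ‖h 0‖)/T²`
    refine ⟨max (max T₁ 1) (Real.sqrt ((1 + ‖h 0‖) / ε)), fun σ hσ T hT => ?_⟩
    have hT₁' : T₁ ≤ |T| := le_trans (le_trans (le_max_left _ _) (le_max_left _ _)) hT
    have hT1 : 1 ≤ |T| := le_trans (le_trans (le_max_right _ _) (le_max_left _ _)) hT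
    have hTε : Real.sqrt ((1 + ‖h 0‖) / ε) ≤ |T| := le_trans (le_max_right _ _) hT
    set z : ℂ := (σ : ℂ) + T * I with hz
    have hzim : z.im = T := by simp [hz]
    have hzre : z.re = σ := by simp [hz]
    have hzn : |T| ≤ ‖z‖ := by
      have := Complex.abs_im_le_norm z; rwa [hzim] at this
    have hz0 : z ≠ 0 := by
      rw [← norm_pos_iff]; linarith
    have hhz : ‖h z‖ ≤ 1 := by
      have := hbound z (by rw [hzre]; exact hσ.1) (by rw [hzre]; exact hσ.2) (by linarith)
      rw [hzim] at this
      exact this.trans (hT₁ T hT₁')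
    rw [sub_zero, hsplit z hz0]
    have hT2 : (1 + ‖h 0‖) / ε ≤ T ^ 2 := by
      have h1 : Real.sqrt ((1 + ‖h 0‖) / ε) ^ 2 = (1 + ‖h 0‖) / ε :=
        Real.sq_sqrt (by positivity)
      rw [← h1, ← sq_abs T]
      exact pow_le_pow_left₀ (Real.sqrt_nonneg _) hTε 2
    have hzsq : T ^ 2 ≤ ‖z‖ ^ 2 := by
      rw [← sq_abs T]; exact pow_le_pow_left₀ (abs_nonneg T) hzn 2
    have hTpos : 0 < T ^ 2 := by
      have : 0 < |T| := by linarith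
      rw [← sq_abs]; exact pow_pos this 2
    calc ‖h z / z ^ 2 - h 0 / z ^ 2‖ ≤ ‖h z / z ^ 2‖ + ‖h 0 / z ^ 2‖ := norm_sub_le _ _
      _ = (‖h z‖ + ‖h 0‖) / ‖z‖ ^ 2 := by rw [norm_div, norm_div, norm_pow, add_div]
      _ ≤ (1 + ‖h 0‖) / T ^ 2 := by
          gcongr
      _ ≤ ε := by
          rw [div_le_iff₀ hTpos]
          rw [div_le_iff₀ hε] at hT2
          linarith
  -- the tree's strip residue theorem for `h₁`
  have hT := integral_vertical_sub_eq_of_pole h₁ 0 (a := a) (b := b) (by simpa using ha)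
    (by simpa using hb) hd₁
    (by simpa using hint₁ (le_refl a) (ha.trans hb).le ha4)
    (by simpa using hint₁ (ha.trans hb).le (le_refl b) hb4) hdecay
  simp only [sub_zero] at hT
  have hderiv : h₁ 0 = deriv h 0 := by rw [hh₁, dslope_same]
  -- split `h/z² = h₁/z + h(0)/z²` on both lines and use `∫ dz/z² = 0`
  have hline : ∀ {c : ℝ}, a ≤ c → c ≤ b → 1 / 4 ≤ |c| →
      (∫ t : ℝ, h (c + t * I) / ((c : ℂ) + t * I) ^ 2) =
        ∫ t : ℝ, h₁ (c + t * I) / ((c : ℂ) + t * I) := by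
    intro c hca hcb hc4
    have hc0 : c ≠ 0 := by intro h; rw [h] at hc4; norm_num at hc4
    have hpt : ∀ t : ℝ, h (c + t * I) / ((c : ℂ) + t * I) ^ 2 =
        h₁ (c + t * I) / ((c : ℂ) + t * I) + h 0 * (((c : ℂ) + t * I) ^ 2)⁻¹ := by
      intro t
      rw [hsplit _ (hline_ne hc0 t)]
      ring
    simp_rw [hpt]
    rw [integral_add (hint₁ hca hcb hc4) ((integrable_inv_sq_line hc0).const_mul _),
      integral_const_mul, integral_inv_sq_line hc0, mul_zero, add_zero]
  rw [hline (ha.trans hb).le (le_refl b) hb4, hline (le_refl a) (ha.trans hb).le ha4, hT, hderiv]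

/-- **Circle formula for a double pole**: `∮_{|z|=R} h(z)/z² dz = 2πi·h′(0)` for `h` holomorphic on
the closed disc (Mathlib's Cauchy formula for the derivative). [folklore] -/
private theorem circleIntegral_div_sq_eq (h : ℂ → ℂ) {R : ℝ} (hR : 0 < R)
    (hd : DifferentiableOn ℂ h (closedBall 0 R)) :
    (∮ z in C(0, R), h z / z ^ 2) = 2 * π * I * deriv h 0 := by
  have key := hd.deriv_eq_smul_circleIntegral hR
  simp only [sub_zero, smul_eq_mul] at key
  rw [← key]
  refine circleIntegral.integral_congr hR.le fun z _ => ?_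
  ring

/-- **Circle formula for a simple pole**: `∮_{|z|=R} h(z)/z dz = 2πi·h(0)`. [folklore] -/
private theorem circleIntegral_div_eq (h : ℂ → ℂ) {R : ℝ} (hR : 0 < R)
    (hd : DifferentiableOn ℂ h (closedBall 0 R)) :
    (∮ z in C(0, R), h z / z) = 2 * π * I * h 0 := by
  have hdc : DiffContOnCl ℂ h (ball 0 R) :=
    (hd.mono (by rw [closure_ball _ hR.ne'])).diffContOnCl
  have key := hdc.circleIntegral_sub_inv_smul (mem_ball_self hR)
  simp only [sub_zero, smul_eq_mul] at key
  rw [← key]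
  refine circleIntegral.integral_congr hR.le fun z _ => ?_
  simp only [div_eq_inv_mul]

end ContourShiftGeneric

/-! ### The divisor kernel `M(z) = ζ₁(1+z)²Γ(z+1)ε(z)` and the numerator on the line `re z = 1` -/

section ContourShift

open MeasureTheory Filter Topology Set Metric
open Literature.NumberTheory.LFunctions.ZetaM4 (integrable_pow_mul_exp exists_pow_mul_exp_le
  integral_pow_mul_exp_le)
open Literature.NumberTheory.LFunctions.HuxleyZeroDetection (integral_vertical_sub_eq_of_pole)

open Literature.NumberTheory.LFunctions.DivisorSumCharSq (eps eps_of_ne_zero differentiable_eps numer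
  numer_div_eq numer_zero gFun differentiableOn_numer norm_numer_le Knum Knum_nonneg
  continuous_numer_div_line numer_horizontal_decay MX norm_eps_le phi)
open Literature.NumberTheory.LFunctions.ZetaM4 (CΓ CΓ_pos norm_Gamma_strip_le)

variable {D : ℕ} [NeZero D] (χ : DirichletCharacter ℂ D)

omit [NeZero D] χ in
/-- `M(z) = ζ₁(1+z)²Γ(z+1)ε(z)` is holomorphic on `re z > −1/2`. [folklore] -/
private theorem differentiableOn_M {X₁ X₂ : ℝ} (hX₁ : 0 < X₁) (hX₂ : 0 < X₂) :
    DifferentiableOn ℂ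
      (fun z : ℂ => riemannZeta₁ (1 + z) ^ 2 * Complex.Gamma (z + 1) * eps X₁ X₂ z)
      {z : ℂ | -(1 / 2) < z.re} := by
  intro z hz
  have hz' : -(1 / 2) < z.re := hz
  refine DifferentiableAt.differentiableWithinAt ?_
  refine DifferentiableAt.mul (DifferentiableAt.mul ?_ ?_) ((differentiable_eps hX₁ hX₂) z)
  · exact ((differentiable_riemannZeta₁.comp
      ((differentiable_const (1 : ℂ)).add differentiable_id)) z).pow 2
  · refine (Complex.differentiableAt_Gamma _ fun m hm => ?_).comp z (differentiableAt_id.add_const 1)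
    have := congrArg Complex.re hm
    simp at this
    have h0 : (0 : ℝ) ≤ m := Nat.cast_nonneg m
    linarith

omit [NeZero D] χ in
/-- `M` in the strip `−1/4 ≤ re z ≤ 2`, `‖z‖ ≥ 1/4`: `‖M(z)‖ ≤ 5⁸ C_Γ (4M_X)(1+|im z|)¹¹e^{−π|im z|/2}`.
[folklore] -/
private theorem norm_M_le {X₁ X₂ : ℝ} (hX₁ : 0 < X₁) (hX₂ : 0 < X₂) {z : ℂ} (h1 : -(1 / 4) ≤ z.re)
    (h2 : z.re ≤ 2) (hz : 1 / 4 ≤ ‖z‖) :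
    ‖riemannZeta₁ (1 + z) ^ 2 * Complex.Gamma (z + 1) * eps X₁ X₂ z‖ ≤
      5 ^ 8 * CΓ * (4 * MX X₁ X₂) * ((1 + |z.im|) ^ 11 * Real.exp (-(π * |z.im| / 2))) := by
  have hy0 := abs_nonneg z.im
  have hzn : ‖z‖ ≤ 2 + |z.im| := by
    have := Complex.norm_le_abs_re_add_abs_im z
    have : |z.re| ≤ 2 := abs_le.2 ⟨by linarith, h2⟩
    linarith
  have h1z : ‖(1 : ℂ) + z‖ ≤ 3 * (1 + |z.im|) := by
    have := norm_add_le (1 : ℂ) z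
    rw [norm_one] at this
    linarith
  have hζ : ‖riemannZeta₁ (1 + z)‖ ≤ 5 ^ 4 * (1 + |z.im|) ^ 4 := by
    have h := BurnolVectors.norm_riemannZeta₁_le (s := 1 + z) (by simp; linarith)
    refine h.trans ?_
    have : ‖(1 : ℂ) + z‖ + 2 ≤ 5 * (1 + |z.im|) := by linarith
    calc (‖(1 : ℂ) + z‖ + 2) ^ 4 ≤ (5 * (1 + |z.im|)) ^ 4 := by gcongr
      _ = 5 ^ 4 * (1 + |z.im|) ^ 4 := by ring
  have hΓ : ‖Complex.Gamma (z + 1)‖ ≤ CΓ * (1 + |z.im|) ^ 3 * Real.exp (-(π * |z.im| / 2)) := by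
    have := norm_Gamma_strip_le (x := z.re + 1) (by linarith) (by linarith) z.im
    have e : ((z.re + 1 : ℝ) : ℂ) + z.im * I = z + 1 := by
      rw [show ((z.re + 1 : ℝ) : ℂ) = (z.re : ℂ) + 1 by push_cast; ring]
      conv_rhs => rw [← Complex.re_add_im z]
      ring
    rwa [e] at this
  have hε := norm_eps_le hX₁ hX₂ h1 h2 hz
  have hC := CΓ_pos
  have hMX : 0 ≤ MX X₁ X₂ := by unfold MX; positivity
  rw [norm_mul, norm_mul, norm_pow]
  calc ‖riemannZeta₁ (1 + z)‖ ^ 2 * ‖Complex.Gamma (z + 1)‖ * ‖eps X₁ X₂ z‖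
      ≤ (5 ^ 4 * (1 + |z.im|) ^ 4) ^ 2 * (CΓ * (1 + |z.im|) ^ 3 * Real.exp (-(π * |z.im| / 2))) *
          (4 * MX X₁ X₂) := by gcongr
    _ = 5 ^ 8 * CΓ * (4 * MX X₁ X₂) * ((1 + |z.im|) ^ 11 * Real.exp (-(π * |z.im| / 2))) := by ring

omit [NeZero D] χ in
/-- `M` on the line `re z = −1/4`, with the smallness of `ε` explicit:
`‖M(z)‖ ≤ 5⁸C_Γ·4(X₂^{−1/4} + X₁^{−1/4})(1+|im z|)¹¹e^{−π|im z|/2}`. [folklore] -/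
private theorem norm_M_line_le {X₁ X₂ : ℝ} (hX₁ : 0 < X₁) (hX₂ : 0 < X₂) {z : ℂ}
    (hzre : z.re = -(1 / 4)) :
    ‖riemannZeta₁ (1 + z) ^ 2 * Complex.Gamma (z + 1) * eps X₁ X₂ z‖ ≤
      5 ^ 8 * CΓ * (4 * (X₂ ^ (-(1 / 4) : ℝ) + X₁ ^ (-(1 / 4) : ℝ))) *
        ((1 + |z.im|) ^ 11 * Real.exp (-(π * |z.im| / 2))) := by
  have hy0 := abs_nonneg z.im
  have hz : 1 / 4 ≤ ‖z‖ := by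
    have := Complex.abs_re_le_norm z
    rw [hzre, abs_neg, abs_of_pos (by norm_num : (0:ℝ) < 1 / 4)] at this
    exact this
  have hz0 : z ≠ 0 := by
    intro h; rw [h, norm_zero] at hz; norm_num at hz
  have h1z : ‖(1 : ℂ) + z‖ ≤ 3 * (1 + |z.im|) := by
    have := norm_add_le (1 : ℂ) z
    have hzn : ‖z‖ ≤ 2 + |z.im| := by
      have := Complex.norm_le_abs_re_add_abs_im z
      rw [hzre, abs_neg, abs_of_pos (by norm_num : (0:ℝ) < 1 / 4)] at this
      linarith
    rw [norm_one] at this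
    linarith
  have hζ : ‖riemannZeta₁ (1 + z)‖ ≤ 5 ^ 4 * (1 + |z.im|) ^ 4 := by
    have h := BurnolVectors.norm_riemannZeta₁_le (s := 1 + z) (by simp; linarith)
    refine h.trans ?_
    have : ‖(1 : ℂ) + z‖ + 2 ≤ 5 * (1 + |z.im|) := by linarith
    calc (‖(1 : ℂ) + z‖ + 2) ^ 4 ≤ (5 * (1 + |z.im|)) ^ 4 := by gcongr
      _ = 5 ^ 4 * (1 + |z.im|) ^ 4 := by ring
  have hΓ : ‖Complex.Gamma (z + 1)‖ ≤ CΓ * (1 + |z.im|) ^ 3 * Real.exp (-(π * |z.im| / 2)) := by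
    have := norm_Gamma_strip_le (x := z.re + 1) (by rw [hzre]; norm_num) (by rw [hzre]; norm_num) z.im
    have e : ((z.re + 1 : ℝ) : ℂ) + z.im * I = z + 1 := by
      rw [show ((z.re + 1 : ℝ) : ℂ) = (z.re : ℂ) + 1 by push_cast; ring]
      conv_rhs => rw [← Complex.re_add_im z]
      ring
    rwa [e] at this
  -- `‖ε(z)‖ ≤ 4 (X₂^{-1/4} + X₁^{-1/4})` on the line
  have hε : ‖eps X₁ X₂ z‖ ≤ 4 * (X₂ ^ (-(1 / 4) : ℝ) + X₁ ^ (-(1 / 4) : ℝ)) := by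
    rw [eps_of_ne_zero _ _ hz0, norm_div]
    have hnum : ‖(X₂ : ℂ) ^ z - (X₁ : ℂ) ^ z‖ ≤ X₂ ^ (-(1 / 4) : ℝ) + X₁ ^ (-(1 / 4) : ℝ) := by
      refine (norm_sub_le _ _).trans ?_
      rw [Complex.norm_cpow_eq_rpow_re_of_pos hX₂, Complex.norm_cpow_eq_rpow_re_of_pos hX₁, hzre]
    have h0 : 0 ≤ X₂ ^ (-(1 / 4) : ℝ) + X₁ ^ (-(1 / 4) : ℝ) := by positivity
    rw [div_le_iff₀ (by linarith)]
    nlinarith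
  have hC := CΓ_pos
  have h0 : 0 ≤ X₂ ^ (-(1 / 4) : ℝ) + X₁ ^ (-(1 / 4) : ℝ) := by positivity
  rw [norm_mul, norm_mul, norm_pow]
  calc ‖riemannZeta₁ (1 + z)‖ ^ 2 * ‖Complex.Gamma (z + 1)‖ * ‖eps X₁ X₂ z‖
      ≤ (5 ^ 4 * (1 + |z.im|) ^ 4) ^ 2 * (CΓ * (1 + |z.im|) ^ 3 * Real.exp (-(π * |z.im| / 2))) *
          (4 * (X₂ ^ (-(1 / 4) : ℝ) + X₁ ^ (-(1 / 4) : ℝ))) := by gcongr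
    _ = _ := by ring

omit [NeZero D] χ in
/-- Integrability of `M(c+iy)/(c+iy)²` on the lines `−1/4 ≤ c ≤ 2`, `|c| ≥ 1/4`. [folklore] -/
private theorem integrable_M_div_sq_line {X₁ X₂ : ℝ} (hX₁ : 0 < X₁) (hX₂ : 0 < X₂) {c : ℝ}
    (hc1 : -(1 / 4) ≤ c) (hc2 : c ≤ 2) (hca : 1 / 4 ≤ |c|) :
    Integrable fun y : ℝ =>
      (riemannZeta₁ (1 + ((c : ℂ) + y * I)) ^ 2 * Complex.Gamma (((c : ℂ) + y * I) + 1) *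
        eps X₁ X₂ ((c : ℂ) + y * I)) / ((c : ℂ) + y * I) ^ 2 := by
  have hc0 : c ≠ 0 := by intro h; rw [h] at hca; norm_num at hca
  set K : ℝ := 5 ^ 8 * CΓ * (4 * MX X₁ X₂) with hK
  have hline : Continuous fun y : ℝ => (c : ℂ) + y * I := by fun_prop
  have hne : ∀ y : ℝ, (c : ℂ) + y * I ≠ 0 := fun y h => by
    have := congrArg Complex.re h; simp at this; exact hc0 this
  have hcont : Continuous fun y : ℝ =>
      (riemannZeta₁ (1 + ((c : ℂ) + y * I)) ^ 2 * Complex.Gamma (((c : ℂ) + y * I) + 1) *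
        eps X₁ X₂ ((c : ℂ) + y * I)) / ((c : ℂ) + y * I) ^ 2 := by
    refine ((differentiableOn_M hX₁ hX₂).continuousOn.comp_continuous hline fun y => by
      show -(1 / 2) < ((c : ℂ) + y * I).re
      simp; linarith).div (hline.pow 2) fun y => pow_ne_zero 2 (hne y)
  refine (((integrable_pow_mul_exp 11).const_mul (K * 16)).mono' hcont.aestronglyMeasurable
    (Eventually.of_forall fun y => ?_))
  set z : ℂ := (c : ℂ) + y * I with hz
  have hzre : z.re = c := by simp [hz]
  have hzim : z.im = y := by simp [hz]
  have hzn : 1 / 4 ≤ ‖z‖ := by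
    have := Complex.abs_re_le_norm z; rw [hzre] at this; exact hca.trans this
  have hb := norm_M_le hX₁ hX₂ (z := z) (by rw [hzre]; exact hc1) (by rw [hzre]; exact hc2) hzn
  rw [← hK, hzim] at hb
  rw [norm_div, norm_pow, div_le_iff₀ (by positivity)]
  have hsq : (1 / 4) ^ 2 ≤ ‖z‖ ^ 2 := pow_le_pow_left₀ (by norm_num) hzn 2
  have hK0 : 0 ≤ K * ((1 + |y|) ^ 11 * Real.exp (-(π * |y| / 2))) := by
    rw [hK]; have := CΓ_pos; have : 0 ≤ MX X₁ X₂ := by unfold MX; positivity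
    positivity
  calc ‖riemannZeta₁ (1 + z) ^ 2 * Complex.Gamma (z + 1) * eps X₁ X₂ z‖
      ≤ K * ((1 + |y|) ^ 11 * Real.exp (-(π * |y| / 2))) := hb
    _ = K * 16 * ((1 + |y|) ^ 11 * Real.exp (-(π * |y| / 2))) * (1 / 4) ^ 2 := by ring
    _ ≤ K * 16 * ((1 + |y|) ^ 11 * Real.exp (-(π * |y| / 2))) * ‖z‖ ^ 2 := by
        have h16 : 0 ≤ K * 16 * ((1 + |y|) ^ 11 * Real.exp (-(π * |y| / 2))) := by linarith [hK0]
        gcongr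

/-- Integrability of `N(c+iy)/(c+iy)` on every line `−1/4 ≤ c ≤ 2` with `|c| ≥ 1/4` (the tree's
`integrable_numer_div_line` states the cases `c = −1/4, 2`; same proof). [folklore] -/
private theorem integrable_numer_div_line' (hχ1 : χ ≠ 1) {X₁ X₂ : ℝ} (hX₁ : 0 < X₁) (hX₂ : 0 < X₂)
    {c : ℝ} (hc1 : -(1 / 4) ≤ c) (hc2 : c ≤ 2) (hca : 1 / 4 ≤ |c|) :
    Integrable fun y : ℝ => numer χ X₁ X₂ (c + y * I) / ((c : ℂ) + y * I - 0) := by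
  have hc0 : c ≠ 0 := by intro h; rw [h] at hca; norm_num at hca
  set K : ℝ := Knum X₁ X₂ D with hK
  have hK0 : 0 ≤ K := Knum_nonneg hX₁ hX₂ D
  have hcont := continuous_numer_div_line χ hχ1 hX₁ hX₂ (c := c) (by linarith) hc0
  refine (((integrable_pow_mul_exp 13).const_mul (K * 4)).mono' hcont.aestronglyMeasurable
    (Eventually.of_forall fun y => ?_))
  rw [sub_zero, norm_div]
  have hw : 1 / 4 ≤ ‖((c : ℂ) + y * I)‖ := by
    have hre : (((c : ℂ) + y * I)).re = c := by simp
    have := Complex.abs_re_le_norm (((c : ℂ) + y * I))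
    rw [hre] at this
    exact hca.trans this
  have him : (((c : ℂ) + y * I)).im = y := by simp
  have hb := norm_numer_le χ hχ1 hX₁ hX₂ (z := ((c : ℂ) + y * I)) (by simpa using hc1)
    (by simpa using hc2) hw
  rw [← hK, him] at hb
  rw [div_le_iff₀ (by linarith)]
  calc ‖numer χ X₁ X₂ ((c : ℂ) + y * I)‖ ≤ K * ((1 + |y|) ^ 13 * Real.exp (-(π * |y| / 2))) := hb
    _ = K * 4 * ((1 + |y|) ^ 13 * Real.exp (-(π * |y| / 2))) * (1 / 4) := by ring
    _ ≤ K * 4 * ((1 + |y|) ^ 13 * Real.exp (-(π * |y| / 2))) * ‖((c : ℂ) + y * I)‖ := by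
        gcongr

/-- **The shift `re z = 1 → re z = −1/4` for the numerator** (the tree's strip residue theorem,
`N` holomorphic on `re z > −1/2` with its only contribution the simple pole of `N(z)/z` at `0`):
`∫ N(1+iy)/(1+iy) dy − ∫ N(−1/4+iy)/(−1/4+iy) dy = 2π N(0)`. [cite: Zhang2022LandauSiegel, §3 p.13] -/
private theorem integral_numer_shift_one (hχ1 : χ ≠ 1) {X₁ X₂ : ℝ} (hX₁ : 0 < X₁) (hX₂ : 0 < X₂) :
    (∫ y : ℝ, numer χ X₁ X₂ ((1 : ℝ) + y * I) / ((((1 : ℝ)) : ℂ) + y * I - 0)) -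
      (∫ y : ℝ, numer χ X₁ X₂ ((-(1 / 4) : ℝ) + y * I) / (((-(1 / 4) : ℝ) : ℂ) + y * I - 0)) =
      2 * π * numer χ X₁ X₂ 0 := by
  have h := integral_vertical_sub_eq_of_pole (numer χ X₁ X₂) 0 (a := -(1 / 4)) (b := 1)
    (by simp) (by simp)
    ((differentiableOn_numer χ hχ1 hX₁ hX₂).mono fun w hw => by
      simp only [mem_setOf_eq]; have := hw.1.1; linarith)
    (integrable_numer_div_line' χ hχ1 hX₁ hX₂ (c := -(1 / 4)) (by norm_num) (by norm_num)
      (by norm_num [abs_of_neg]))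
    (integrable_numer_div_line' χ hχ1 hX₁ hX₂ (c := 1) (by norm_num) (by norm_num) (by norm_num))
    (fun ε hε => by
      obtain ⟨T₀, hT₀⟩ := numer_horizontal_decay χ hχ1 hX₁ hX₂ ε hε
      exact ⟨T₀, fun σ hσ T hT => hT₀ σ ⟨hσ.1, hσ.2.trans (by norm_num)⟩ T hT⟩)
  simpa using h

/-- **The integrand of `Z22:§3.u007` splits** off its poles: for `z ≠ 0, −1, −2, …`,
`φ(1+z)ζ(1+z)²L(1+z,χ)²(P^{2z} − D^{4z})Γ(z) = N(z)/z + g(0)·M(z)/z²` with the tree's numerator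
`N = ζ₁(1+z)²Γ(z+1)ε(z)·(g(z) − g(0))/z` (`DivisorSumCharSq.numer`, `X₁ = D⁴`, `X₂ = P²`,
`g = L(1+·,χ)²φ(1+·)`) and the divisor kernel `M = ζ₁(1+z)²Γ(z+1)ε(z)`. [folklore] -/
private theorem integrand31_eq_split {z : ℂ} (hz : z ≠ 0) (hz' : ∀ m : ℕ, z ≠ -(m : ℂ)) :
    integrand31 χ z =
      numer χ ((D : ℝ) ^ 4) (Skeleton.bigP D ^ 2) z / z +
        gFun χ 0 * ((riemannZeta₁ (1 + z) ^ 2 * Complex.Gamma (z + 1) *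
          eps ((D : ℝ) ^ 4) (Skeleton.bigP D ^ 2) z) / z ^ 2) := by
  have hDpos : (0 : ℝ) < D := by exact_mod_cast Nat.pos_of_ne_zero (NeZero.ne D)
  have hP : 0 < Skeleton.bigP D := by unfold Skeleton.bigP; exact Real.exp_pos _
  have h1 : (1 : ℂ) + z ≠ 1 := by intro h; apply hz; linear_combination h
  have hζ₁ : riemannZeta₁ (1 + z) = z * riemannZeta (1 + z) := by
    rw [LFunctions.riemannZeta₁_eq_mul h1, add_sub_cancel_left]
  have hΓ : Complex.Gamma (z + 1) = z * Complex.Gamma z := Complex.Gamma_add_one z hz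
  have hε : eps ((D : ℝ) ^ 4) (Skeleton.bigP D ^ 2) z =
      ((((Skeleton.bigP D ^ 2 : ℝ)) : ℂ) ^ z - ((((D : ℝ) ^ 4 : ℝ)) : ℂ) ^ z) / z :=
    eps_of_ne_zero _ _ hz
  have hPpow : (((Skeleton.bigP D : ℝ)) : ℂ) ^ (2 * z) = ((((Skeleton.bigP D ^ 2 : ℝ)) : ℂ)) ^ z := by
    rw [ofReal_cpow_eq_exp_log hP, ofReal_cpow_eq_exp_log (by positivity), Real.log_pow]
    push_cast; ring_nf
  have hDpow : (((D : ℝ)) : ℂ) ^ (4 * z) = ((((D : ℝ) ^ 4 : ℝ)) : ℂ) ^ z := by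
    rw [ofReal_cpow_eq_exp_log hDpos, ofReal_cpow_eq_exp_log (by positivity), Real.log_pow]
    push_cast; ring_nf
  rw [numer_div_eq χ hz hz', integrand31, hζ₁, hΓ, hε, hPpow, hDpow,
    DivisorSumCharSq.gFun_def, DivisorSumCharSq.gFun_def]
  field_simp
  ring


/-- **`Z22:§3.u007` holds** (DISCHARGED, `c = 1/4`): «Moving the line of integration to the left
appropriately … the right side is equal to the residue of the integrand plus an acceptable error
`O(D^{−c})`; the residue at `s = 0` can be written as `(1/2πi)∫_{|s|=α*} …».  Proof: split the
integrand as `N(z)/z + g(0)M(z)/z²` (`integrand31_eq_split`); shift `N(z)/z` from `re z = 1` to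
`re z = −1/4` across its simple pole (tree strip residue theorem) and `M(z)/z²` across its double pole
(`integral_vertical_sub_eq_of_double_pole`); the residues are exactly the small-circle integrals
(Cauchy's formulae `circleIntegral_div_eq`, `circleIntegral_div_sq_eq`, radius `α* ≤ 1/4`); what is
left is `(1/2π)∫_{(−1/4)} N(z)/z + (g(0)/2π)∫_{(−1/4)} M(z)/z²`, and on that line `|D^{4z}| = D⁻¹`,
`|P^{2z}| = P^{−1/2} ≤ D⁻¹`: the tree's `Lemma31.norm_integral_line_le` (Pólya–Vinogradov convexity
bound for `L(3/4+iy,χ)`, giving `d(D)²D^{1/4}(1+𝓛)³·D⁻¹`) and `norm_M_line_le`, with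
`d(D) ≪ D^{1/8}`, `(1+𝓛)³ ≪ D^{1/4}`, `‖g(0)‖ ≤ 3` under (A). [cite: Zhang2022LandauSiegel, §3 p.13] -/
theorem step3u007_holds : Step3u007 := by
  obtain ⟨Cd, hCd1, hCd⟩ :=
    Literature.NumberTheory.Sieve.exists_card_divisors_le_mul_rpow' (ε := 1 / 8) (by norm_num)
  -- the two absolute constants of the shifted integrals
  set KA : ℝ := 8 * 28 ^ 13 * Lemma31.Kline * Cd ^ 2 * 2197 * 2 with hKA
  set KB : ℝ := 16 * (5 ^ 8 * CΓ * 4 * 2) * (2 * 24 ^ 11) with hKB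
  refine ⟨1 / 4, by norm_num, 1 / (2 * π) * (KA + 3 * KB), 9, fun D _ χ hD hq hprim hA => ?_⟩
  -- basic facts about `D`
  have hχ : χ ^ 2 = 1 := hq.sq_eq_one
  have hD8 : 8 ≤ D := le_trans (by norm_num) hD
  have hD2 : 2 ≤ D := le_trans (by norm_num) hD
  have hDpos : (0 : ℝ) < D := by exact_mod_cast Nat.pos_of_ne_zero (NeZero.ne D)
  have hD1 : (1 : ℝ) ≤ D := by exact_mod_cast le_trans (by norm_num) hD
  set ℓ : ℝ := Skeleton.ell D with hℓdef
  have hℓlog : ℓ = Real.log D := rfl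
  have hℓ2 : 2 ≤ ℓ := two_le_ell hD
  have hℓ1 : 1 ≤ ℓ := by linarith
  have hℓ0 : 0 < ℓ := by linarith
  have hlog1 : 1 ≤ Real.log D := hℓ1
  have hχ1 : χ ≠ 1 := Lemma31.ne_one_of_isPrimitive χ hD2 hprim
  have hL1 : ‖χ.LFunction 1‖ ≤ 1 := by
    have h := hA
    unfold Skeleton.AssumptionA at h
    refine h.le.trans ?_
    rw [div_le_one (by positivity)]
    exact one_le_pow₀ hlog1
  -- the parameters
  set X₁ : ℝ := (D : ℝ) ^ 4 with hX₁def
  set X₂ : ℝ := Skeleton.bigP D ^ 2 with hX₂def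
  have hP : 0 < Skeleton.bigP D := by unfold Skeleton.bigP; exact Real.exp_pos _
  have hX₁ : 0 < X₁ := by positivity
  have hX₂ : 0 < X₂ := by positivity
  set R : ℝ := alphaStar D with hRdef
  have hR : R = (ℓ ^ 2024)⁻¹ := rfl
  have hR0 : 0 < R := by rw [hR]; positivity
  have hR4 : R ≤ 1 / 4 := by
    rw [hR]
    have h4 : (4 : ℝ) ≤ ℓ ^ 2024 :=
      calc (4 : ℝ) = 2 ^ 2 := by norm_num
        _ ≤ 2 ^ 2024 := pow_le_pow_right₀ (by norm_num) (by norm_num)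
        _ ≤ ℓ ^ 2024 := pow_le_pow_left₀ (by norm_num) hℓ2 2024
    rw [one_div]; exact inv_anti₀ (by norm_num) h4
  -- the two kernels
  set N : ℂ → ℂ := numer χ X₁ X₂ with hNdef
  set M : ℂ → ℂ := fun z : ℂ => riemannZeta₁ (1 + z) ^ 2 * Complex.Gamma (z + 1) * eps X₁ X₂ z
    with hMdef
  set g0 : ℂ := gFun χ 0 with hg0def
  have hdN : DifferentiableOn ℂ N {z : ℂ | -(1 / 2) < z.re} := differentiableOn_numer χ hχ1 hX₁ hX₂
  have hdM : DifferentiableOn ℂ M {z : ℂ | -(1 / 2) < z.re} := differentiableOn_M hX₁ hX₂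
  have hball : closedBall (0 : ℂ) R ⊆ {z : ℂ | -(1 / 2) < z.re} := by
    intro z hz
    rw [mem_closedBall, dist_zero_right] at hz
    have := neg_le_of_abs_le ((Complex.abs_re_le_norm z).trans hz)
    show -(1 / 2) < z.re
    linarith
  -- (1) the split on the line `re z = 1`
  have hsplit1 : ∀ y : ℝ, integrand31 χ (1 + y * I) =
      N (1 + y * I) / ((1 : ℂ) + y * I) + g0 * (M (1 + y * I) / ((1 : ℂ) + y * I) ^ 2) := by
    intro y
    have hz : (1 : ℂ) + y * I ≠ 0 := fun h => by
      have := congrArg Complex.re h; simp at this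
    have hz' : ∀ m : ℕ, (1 : ℂ) + y * I ≠ -(m : ℂ) := fun m h => by
      have := congrArg Complex.re h; simp at this; linarith [(Nat.cast_nonneg m : (0:ℝ) ≤ m)]
    exact integrand31_eq_split χ hz hz'
  have hIN1 : Integrable fun y : ℝ => N (1 + y * I) / ((1 : ℂ) + y * I) := by
    simpa using integrable_numer_div_line' χ hχ1 hX₁ hX₂ (c := 1) (by norm_num) (by norm_num)
      (by norm_num)
  have hIM1 : Integrable fun y : ℝ => M (1 + y * I) / ((1 : ℂ) + y * I) ^ 2 := by
    simpa using integrable_M_div_sq_line hX₁ hX₂ (c := 1) (by norm_num) (by norm_num) (by norm_num)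
  have hline1 : (∫ y : ℝ, integrand31 χ (1 + y * I)) =
      (∫ y : ℝ, N (1 + y * I) / ((1 : ℂ) + y * I)) +
        g0 * ∫ y : ℝ, M (1 + y * I) / ((1 : ℂ) + y * I) ^ 2 := by
    simp_rw [hsplit1]
    rw [integral_add hIN1 (hIM1.const_mul g0), integral_const_mul]
  -- (2) the circle
  have hcirc : (∮ z in C(0, R), integrand31 χ z) =
      2 * π * I * N 0 + g0 * (2 * π * I * deriv M 0) := by
    have hsphere : ∀ z ∈ sphere (0 : ℂ) R, integrand31 χ z = N z / z + g0 * (M z / z ^ 2) := by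
      intro z hz
      rw [mem_sphere_zero_iff_norm] at hz
      have hz0 : z ≠ 0 := by rw [← norm_pos_iff, hz]; exact hR0
      have hz' : ∀ m : ℕ, z ≠ -(m : ℂ) := by
        intro m h
        rcases Nat.eq_zero_or_pos m with hm | hm
        · rw [hm] at h; simp at h; exact hz0 h
        · have : ‖z‖ = m := by rw [h, norm_neg]; simp
          rw [hz] at this
          have h1 : (1 : ℝ) ≤ m := by exact_mod_cast hm
          linarith
      exact integrand31_eq_split χ hz0 hz'
    rw [circleIntegral.integral_congr hR0.le hsphere]
    have hcN : CircleIntegrable (fun z => N z / z) 0 R := by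
      refine ContinuousOn.circleIntegrable hR0.le ?_
      refine ((hdN.mono hball).continuousOn.mono sphere_subset_closedBall).div continuousOn_id
        fun z hz => ?_
      rw [mem_sphere_zero_iff_norm] at hz
      rw [← norm_pos_iff, hz]; exact hR0
    have hcM : CircleIntegrable (fun z => g0 * (M z / z ^ 2)) 0 R := by
      refine ContinuousOn.circleIntegrable hR0.le (continuousOn_const.mul ?_)
      refine ((hdM.mono hball).continuousOn.mono sphere_subset_closedBall).div
        (continuousOn_id.pow 2) fun z hz => ?_
      rw [mem_sphere_zero_iff_norm] at hz
      exact pow_ne_zero 2 (by rw [← norm_pos_iff, hz]; exact hR0)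
    rw [circleIntegral.integral_add hcN hcM, circleIntegral.integral_const_mul,
      circleIntegral_div_eq N hR0 (hdN.mono hball), circleIntegral_div_sq_eq M hR0 (hdM.mono hball)]
  -- (3) the two shifts `re z = 1 → re z = −1/4`
  have hshiftN := integral_numer_shift_one χ hχ1 hX₁ hX₂
  simp only [Complex.ofReal_one, sub_zero] at hshiftN
  have hKM0 : 0 ≤ 5 ^ 8 * CΓ * (4 * MX X₁ X₂) := by
    have := CΓ_pos; have : 0 ≤ MX X₁ X₂ := by unfold MX; positivity
    positivity
  have hshiftM := integral_vertical_sub_eq_of_double_pole M (a := -(1 / 4)) (b := 1)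
    (by norm_num) (by norm_num) (by norm_num [abs_of_neg]) (by norm_num)
    (hdM.mono fun w hw => by have := hw.1.1; show -(1 / 2) < w.re; linarith) hKM0
    (fun z h1 h2 hz => norm_M_le hX₁ hX₂ h1 (h2.trans (by norm_num)) hz)
  simp only [Complex.ofReal_one] at hshiftM
  -- (4) algebra: everything except the two integrals on `re z = −1/4` cancels
  set A₂ : ℂ := ∫ y : ℝ, N ((-(1 / 4) : ℝ) + y * I) / (((-(1 / 4) : ℝ) : ℂ) + y * I) with hA₂
  set B₂ : ℂ := ∫ y : ℝ, M ((-(1 / 4) : ℝ) + y * I) / (((-(1 / 4) : ℝ) : ℂ) + y * I) ^ 2 with hB₂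
  have hA₁ : (∫ y : ℝ, N (1 + y * I) / ((1 : ℂ) + y * I)) = A₂ + 2 * π * N 0 := by
    linear_combination hshiftN
  have hB₁ : (∫ y : ℝ, M (1 + y * I) / ((1 : ℂ) + y * I) ^ 2) = B₂ + 2 * π * deriv M 0 := by
    linear_combination hshiftM
  have hπ : (π : ℂ) ≠ 0 := Complex.ofReal_ne_zero.mpr Real.pi_pos.ne'
  have hexpr : (1 / (2 * π)) * (∫ y : ℝ, integrand31 χ (1 + y * I)) -
      (1 / (2 * π * I)) * (∮ z in C(0, alphaStar D), integrand31 χ z) =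
      (1 / (2 * π)) * A₂ + g0 * ((1 / (2 * π)) * B₂) := by
    rw [hline1, hA₁, hB₁, ← hRdef, hcirc]
    field_simp
    ring
  rw [hexpr]
  -- (5) the bounds on `re z = −1/4`
  have hBN : ‖A₂‖ ≤ 8 * 28 ^ 13 * (Lemma31.Kline * (D.divisors.card : ℝ) ^ 2 * (D : ℝ) ^ (1 / 4 : ℝ) *
      (1 + Real.log D) ^ 3 * (X₁ ^ (-(1 / 4) : ℝ) + X₂ ^ (-(1 / 4) : ℝ))) := by
    have h := Lemma31.norm_integral_line_le χ hprim hD8 hlog1 hL1 hX₁ hX₂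
    simp only [sub_zero] at h
    exact h
  have hBM : ‖B₂‖ ≤ 16 * (5 ^ 8 * CΓ * (4 * (X₂ ^ (-(1 / 4) : ℝ) + X₁ ^ (-(1 / 4) : ℝ)))) *
      (2 * 24 ^ 11) := by
    set KL : ℝ := 5 ^ 8 * CΓ * (4 * (X₂ ^ (-(1 / 4) : ℝ) + X₁ ^ (-(1 / 4) : ℝ))) with hKL
    have hKL0 : 0 ≤ KL := by rw [hKL]; have := CΓ_pos; positivity
    have hpt : ∀ y : ℝ, ‖M ((-(1 / 4) : ℝ) + y * I) / (((-(1 / 4) : ℝ) : ℂ) + y * I) ^ 2‖ ≤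
        16 * KL * ((1 + |y|) ^ 11 * Real.exp (-(π * |y| / 2))) := by
      intro y
      set z : ℂ := (((-(1 / 4) : ℝ)) : ℂ) + y * I with hz
      have hzre : z.re = -(1 / 4) := by simp [hz]
      have hzim : z.im = y := by simp [hz]
      have hzn : 1 / 4 ≤ ‖z‖ := by
        have := Complex.abs_re_le_norm z
        rw [hzre, abs_neg, abs_of_pos (by norm_num : (0:ℝ) < 1 / 4)] at this
        exact this
      have hb := norm_M_line_le hX₁ hX₂ (z := z) hzre
      rw [← hKL, hzim] at hb
      rw [norm_div, norm_pow, div_le_iff₀ (by positivity)]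
      have hsq : (1 / 4) ^ 2 ≤ ‖z‖ ^ 2 := pow_le_pow_left₀ (by norm_num) hzn 2
      have h16 : 0 ≤ 16 * KL * ((1 + |y|) ^ 11 * Real.exp (-(π * |y| / 2))) := by positivity
      calc ‖M z‖ ≤ KL * ((1 + |y|) ^ 11 * Real.exp (-(π * |y| / 2))) := hb
        _ = 16 * KL * ((1 + |y|) ^ 11 * Real.exp (-(π * |y| / 2))) * (1 / 4) ^ 2 := by ring
        _ ≤ 16 * KL * ((1 + |y|) ^ 11 * Real.exp (-(π * |y| / 2))) * ‖z‖ ^ 2 := by gcongr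
    have hint := (integrable_pow_mul_exp 11).const_mul (16 * KL)
    calc ‖B₂‖ ≤ ∫ y : ℝ, 16 * KL * ((1 + |y|) ^ 11 * Real.exp (-(π * |y| / 2))) :=
          norm_integral_le_of_norm_le hint (Eventually.of_forall hpt)
      _ = 16 * KL * ∫ y : ℝ, (1 + |y|) ^ 11 * Real.exp (-(π * |y| / 2)) := integral_const_mul _ _
      _ ≤ 16 * KL * (2 * (2 * (11 : ℕ) + 2) ^ 11) := by
          gcongr; exact integral_pow_mul_exp_le 11
      _ = 16 * KL * (2 * 24 ^ 11) := by norm_num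
  have hg0 : ‖g0‖ ≤ 3 := Lemma31.norm_gFun_zero_le χ hlog1 hL1
  -- (6) the smallness of `X₁^{-1/4} = D⁻¹` and `X₂^{-1/4} = P^{-1/2} ≤ D⁻¹`
  have hX₁q : X₁ ^ (-(1 / 4) : ℝ) = (D : ℝ)⁻¹ := by
    rw [hX₁def, ← Real.rpow_natCast, ← Real.rpow_mul hDpos.le]
    norm_num
    exact Real.rpow_neg_one (D : ℝ)
  have hX₂q : X₂ ^ (-(1 / 4) : ℝ) ≤ (D : ℝ)⁻¹ := by
    rw [hX₂def]
    unfold Skeleton.bigP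
    rw [← Real.exp_nat_mul, ← Real.exp_mul, ← hℓdef]
    have hDinv : (D : ℝ)⁻¹ = Real.exp (-ℓ) := by
      rw [hℓlog, Real.exp_neg, Real.exp_log hDpos]
    rw [hDinv, Real.exp_le_exp]
    have h8 : (2 : ℝ) ≤ ℓ ^ 8 := le_trans (by norm_num) (pow_le_pow_left₀ (by norm_num) hℓ2 8)
    nlinarith
  have hsum : X₁ ^ (-(1 / 4) : ℝ) + X₂ ^ (-(1 / 4) : ℝ) ≤ 2 * (D : ℝ)⁻¹ := by linarith [hX₁q.le]
  -- (7) `d(D)² ≤ Cd² D^{1/4}`, `(1 + log D)³ ≤ 2197 D^{1/4}`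
  have hdiv : (D.divisors.card : ℝ) ^ 2 ≤ Cd ^ 2 * (D : ℝ) ^ (1 / 4 : ℝ) := by
    have h := hCd D
    have h0 : (0 : ℝ) ≤ D.divisors.card := Nat.cast_nonneg _
    calc (D.divisors.card : ℝ) ^ 2 ≤ (Cd * (D : ℝ) ^ (1 / 8 : ℝ)) ^ 2 := pow_le_pow_left₀ h0 h 2
      _ = Cd ^ 2 * ((D : ℝ) ^ (1 / 8 : ℝ)) ^ 2 := by ring
      _ = Cd ^ 2 * (D : ℝ) ^ (1 / 4 : ℝ) := by
          rw [← Real.rpow_natCast ((D : ℝ) ^ (1 / 8 : ℝ)) 2, ← Real.rpow_mul hDpos.le]; norm_num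
  have hlog3 : (1 + Real.log D) ^ 3 ≤ 2197 * (D : ℝ) ^ (1 / 4 : ℝ) := by
    have h1 : Real.log D ≤ 12 * (D : ℝ) ^ (1 / 12 : ℝ) := by
      have := Real.log_le_rpow_div hDpos.le (by norm_num : (0:ℝ) < 1 / 12)
      linarith
    have h2 : (1 : ℝ) ≤ (D : ℝ) ^ (1 / 12 : ℝ) := Real.one_le_rpow hD1 (by norm_num)
    have h3 : 1 + Real.log D ≤ 13 * (D : ℝ) ^ (1 / 12 : ℝ) := by linarith
    have h0 : 0 ≤ 1 + Real.log D := by linarith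
    calc (1 + Real.log D) ^ 3 ≤ (13 * (D : ℝ) ^ (1 / 12 : ℝ)) ^ 3 := pow_le_pow_left₀ h0 h3 3
      _ = 2197 * ((D : ℝ) ^ (1 / 12 : ℝ)) ^ 3 := by ring
      _ = 2197 * (D : ℝ) ^ (1 / 4 : ℝ) := by
          rw [← Real.rpow_natCast ((D : ℝ) ^ (1 / 12 : ℝ)) 3, ← Real.rpow_mul hDpos.le]; norm_num
  -- (8) assemble the bound `≤ (1/2π)(KA + 3 KB) D^{-1/4}`
  have hquarter : (D : ℝ) ^ (1 / 4 : ℝ) * (D : ℝ) ^ (1 / 4 : ℝ) * (D : ℝ) ^ (1 / 4 : ℝ) * (D : ℝ)⁻¹ =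
      (D : ℝ) ^ (-(1 / 4) : ℝ) := by
    rw [← Real.rpow_neg_one, ← Real.rpow_add hDpos, ← Real.rpow_add hDpos, ← Real.rpow_add hDpos]
    norm_num
  have hDq : (D : ℝ)⁻¹ ≤ (D : ℝ) ^ (-(1 / 4) : ℝ) := by
    rw [← Real.rpow_neg_one]
    exact Real.rpow_le_rpow_of_exponent_le hD1 (by norm_num)
  have hKline := Lemma31.Kline_pos
  have hCΓ := CΓ_pos
  have hA₂' : ‖A₂‖ ≤ KA * (D : ℝ) ^ (-(1 / 4) : ℝ) := by
    refine hBN.trans ?_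
    have h0 : 0 ≤ (D : ℝ) ^ (1 / 4 : ℝ) := by positivity
    calc 8 * 28 ^ 13 * (Lemma31.Kline * (D.divisors.card : ℝ) ^ 2 * (D : ℝ) ^ (1 / 4 : ℝ) *
          (1 + Real.log D) ^ 3 * (X₁ ^ (-(1 / 4) : ℝ) + X₂ ^ (-(1 / 4) : ℝ)))
        ≤ 8 * 28 ^ 13 * (Lemma31.Kline * (Cd ^ 2 * (D : ℝ) ^ (1 / 4 : ℝ)) * (D : ℝ) ^ (1 / 4 : ℝ) *
          (2197 * (D : ℝ) ^ (1 / 4 : ℝ)) * (2 * (D : ℝ)⁻¹)) := by gcongr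
      _ = KA * ((D : ℝ) ^ (1 / 4 : ℝ) * (D : ℝ) ^ (1 / 4 : ℝ) * (D : ℝ) ^ (1 / 4 : ℝ) * (D : ℝ)⁻¹) := by
          rw [hKA]; ring
      _ = KA * (D : ℝ) ^ (-(1 / 4) : ℝ) := by rw [hquarter]
  have hB₂' : ‖B₂‖ ≤ KB * (D : ℝ) ^ (-(1 / 4) : ℝ) := by
    refine hBM.trans ?_
    have hsum' : X₂ ^ (-(1 / 4) : ℝ) + X₁ ^ (-(1 / 4) : ℝ) ≤ 2 * (D : ℝ) ^ (-(1 / 4) : ℝ) := by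
      linarith
    calc 16 * (5 ^ 8 * CΓ * (4 * (X₂ ^ (-(1 / 4) : ℝ) + X₁ ^ (-(1 / 4) : ℝ)))) * (2 * 24 ^ 11)
        ≤ 16 * (5 ^ 8 * CΓ * (4 * (2 * (D : ℝ) ^ (-(1 / 4) : ℝ)))) * (2 * 24 ^ 11) := by gcongr
      _ = KB * (D : ℝ) ^ (-(1 / 4) : ℝ) := by rw [hKB]; ring
  have hnorm2π : ‖(1 / (2 * π) : ℂ)‖ = 1 / (2 * π) := by
    rw [norm_div, norm_one, norm_mul, Complex.norm_real, Real.norm_of_nonneg Real.pi_pos.le]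
    simp
  have hKA0 : 0 ≤ KA := by rw [hKA]; positivity
  have hKB0 : 0 ≤ KB := by rw [hKB]; positivity
  have hDq0 : 0 ≤ (D : ℝ) ^ (-(1 / 4) : ℝ) := by positivity
  calc ‖(1 / (2 * π)) * A₂ + g0 * ((1 / (2 * π)) * B₂)‖
      ≤ ‖(1 / (2 * π)) * A₂‖ + ‖g0 * ((1 / (2 * π)) * B₂)‖ := norm_add_le _ _
    _ = 1 / (2 * π) * ‖A₂‖ + ‖g0‖ * (1 / (2 * π) * ‖B₂‖) := by
        rw [norm_mul, norm_mul, norm_mul, hnorm2π]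
    _ ≤ 1 / (2 * π) * (KA * (D : ℝ) ^ (-(1 / 4) : ℝ)) + 3 * (1 / (2 * π) * (KB * (D : ℝ) ^ (-(1 / 4) : ℝ))) := by
        gcongr
    _ = 1 / (2 * π) * (KA + 3 * KB) * (D : ℝ) ^ (-(1 / 4) : ℝ) := by ring

/-- `Step3u007` — `_holds` alias of `step3u007_holds` above under the fact's exact name (appended
2026-08-28, D-0026 bookkeeping: the proof term is the existing theorem of this file; no statement,
definition or attribute is edited; no new named fact; the ledger's debt table listed the fact
unproved). [cite: Zhang2022LandauSiegel, §3 p.13] -/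
theorem _root_.Literature.NumberTheory.LFunctions.Zhang2022.Section3.Step3u007_holds : Step3u007 :=
  _root_.Literature.NumberTheory.LFunctions.Zhang2022.Section3.step3u007_holds

end ContourShift

end Literature.NumberTheory.LFunctions.Zhang2022.Section3
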